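import Mathlib.Analysis.SpecialFunctions.SmoothTransition
import Mathlib.Analysis.Calculus.LineDeriv.IntegrationByParts
import Literature.Analysis.UnboundedOperators.HeatFlowTimeDependentData
import Literature.Analysis.UnboundedOperators.HeatKernelGradient
import Literature.Analysis.Calculus.ScaledCutoffFamily
import HarnessLib

/-!
# The parabolic mean-value inequality for smooth subsolutions of the heat equation

Analysis/PDE support file (everything proved; no definitions, no named facts). For a smooth
function `w ≥ 0` on a neighbourhood of the standard parabolic cylinder
`Q_ρ(t₀, y₀) = [t₀ − ρ², t₀] × B̄_ρ(y₀)` in a finite-dimensional real inner product space `E`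
(`n = dim E`) satisfying `∂ₜw − Δw ≤ 0` on `Q_ρ`, the value at the top centre is controlled by
the space-time mean:

  `w(t₀, y₀) ≤ C(E) ρ^{-(n+2)} ∫_{t₀-ρ²}^{t₀} ∫_{B̄_ρ(y₀)} w`.

This is the classical local maximum principle / sub-mean-value property (Lieberman, *Second Order
Parabolic Differential Equations*, Thm. 6.17 with `m = 1`, Thm. 7.36 with `p = 1`, `f = 0`,
specialised to the heat operator and smooth nonnegative subsolutions), the form used in
Moser/Schoen-type `ε`-regularity arguments for geometric flows (harmonic map flow, Yang–Mills flow).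

Proof (representation formula): with a time cut-off `ψ` (rising on `[t₀ − 3ρ²/4, t₀ − ρ²/4]`)
and a space cut-off `φ` (equal to `1` on `B̄_{ρ/2}(y₀)`, supported in `B_ρ(y₀)`), the function
`U = ψ φ w` is smooth with compact support, vanishes at time `t₀ − 7ρ²/8`, and Duhamel's formula
(`Literature.Analysis.UnboundedOperators.HeatFlow.eq_heatExtension_add_integral`) gives
`w(t₀,y₀) = U(t₀,y₀) = ∫∫ G(t₀ − τ, y₀ − z) (∂_τ − Δ)U`. Expanding
`(∂_τ − Δ)(ψφw) = ψφ(∂_τ − Δ)w + (ψ'φ − ψΔφ) w − 2ψ⟨∇φ, ∇w⟩`, dropping the first term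
(`G ≥ 0`, subsolution), and integrating the last by parts onto `G∇φ`, every remaining weight is
supported where `G(t₀ − τ, y₀ − z)` and its gradient are `O(ρ^{-n-2})` (time lag `≥ ρ²/4`, or
`|y₀ − z| ≥ ρ/2`).

Main results:
* `eq_intervalIntegral_heatExtension_of_contDiff` — Duhamel's formula for a smooth compactly
  supported space-time function vanishing at the initial time;
* `exists_heatKernel_le_of_le_norm`, `exists_heatKernel_div_mul_norm_le_of_le_norm` —
  off-diagonal bounds `G_σ(x), G_σ(x)|x|/(2σ) = O(ρ^{-n}), O(ρ^{-n-1})` for `|x| ≥ ρ/2`, uniformly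
  in `σ > 0`;
* `integral_heatKernel_mul_source_le` — the fixed-time estimate (sign of the transport term,
  integration by parts of the cross term);
* `le_mul_integral_of_heat_subsolution` — the mean-value inequality (Laplacian form);
* `le_mul_integral_of_heat_subsolution_basis` — the same with `Δ` written as `∑ᵢ ∂ᵢ∂ᵢ` in an
  orthonormal basis.

## References

* G. M. Lieberman, *Second Order Parabolic Differential Equations*, World Scientific 1996,
  Thm. 6.17 (local supremum estimate for subsolutions, any exponent `m > 0`) and Thm. 7.36
  (local maximum principle, any `p > 0`). [Lieberman1996]
* L. C. Evans, *Partial Differential Equations*, 2nd ed., §2.3.1(c) (Duhamel's principle),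
  §2.3.2 (mean-value property for the heat equation). [Evans2010]
-/

noncomputable section

open MeasureTheory Set Function Filter Metric Real intervalIntegral
open _root_.Topology
open scoped NNReal Laplacian InnerProductSpace ContDiff
open Literature.Analysis.UnboundedOperators

namespace Literature.Analysis.PDE

variable {E : Type*} [NormedAddCommGroup E] [InnerProductSpace ℝ E] [FiniteDimensional ℝ E]
  [MeasurableSpace E] [BorelSpace E]

/-! ### Elementary bounds for the Gauss–Weierstrass kernel away from the pole -/

omit [FiniteDimensional ℝ E] [MeasurableSpace E] [BorelSpace E] in
/-- The heat kernel with the normalisation written as an integer power: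
`G_σ(x) = (√(4πσ))^{-n} exp(−|x|²/(4σ))` for `σ > 0`. [folklore] -/
theorem heatKernel_eq_inv_sqrt_pow {σ : ℝ} (hσ : 0 < σ) (x : E) :
    heatKernel σ x = (Real.sqrt (4 * π * σ))⁻¹ ^ Module.finrank ℝ E *
      Real.exp (-‖x‖ ^ 2 / (4 * σ)) := by
  unfold heatKernel
  congr 1
  have h4 : 0 ≤ 4 * π * σ := by positivity
  rw [neg_div, Real.rpow_neg h4, inv_pow, Real.sqrt_eq_rpow, ← Real.rpow_natCast,
    ← Real.rpow_mul h4]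
  congr 2
  ring

/-- `u^m e^{-u} ≤ m!` for `u ≥ 0`. [folklore] -/
private theorem pow_mul_exp_neg_le_factorial' {u : ℝ} (hu : 0 ≤ u) (m : ℕ) :
    u ^ m * Real.exp (-u) ≤ (m.factorial : ℝ) := by
  have h := Real.pow_div_factorial_le_exp (hx := hu) (n := m)
  have hf : (0 : ℝ) < m.factorial := by positivity
  rw [div_le_iff₀ hf] at h
  rw [Real.exp_neg]
  calc u ^ m * (Real.exp u)⁻¹ ≤ (Real.exp u * m.factorial) * (Real.exp u)⁻¹ := by gcongr
    _ = m.factorial := by field_simp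

omit [InnerProductSpace ℝ E] [FiniteDimensional ℝ E] [MeasurableSpace E] [BorelSpace E] in
/-- `exp(-a) ≤ 1` for the Gaussian exponents `a = |x|²/(cσ) ≥ 0`. [folklore] -/
private theorem exp_neg_sq_div_le_one (x : E) {c : ℝ} (hc : 0 ≤ c) :
    Real.exp (-‖x‖ ^ 2 / c) ≤ 1 := by
  rw [Real.exp_le_one_iff]
  exact div_nonpos_of_nonpos_of_nonneg (neg_nonpos.2 (sq_nonneg _)) hc

omit [FiniteDimensional ℝ E] [MeasurableSpace E] [BorelSpace E] in
/-- **Off-diagonal Gaussian bound with half the exponent.** There is `C = C(n) ≥ 0` with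
`(√(4πσ))^{-n} exp(−|x|²/(8σ)) ≤ C ρ^{-n}` whenever `σ > 0`, `ρ > 0` and `|x| ≥ ρ/2`
(maximise `σ^{-n/2} e^{-ρ²/(32σ)}` over `σ`). [folklore] -/
theorem exists_inv_sqrt_pow_mul_exp_le :
    ∃ C : ℝ, 0 ≤ C ∧ ∀ {σ ρ : ℝ}, 0 < σ → 0 < ρ → ∀ x : E, ρ / 2 ≤ ‖x‖ →
      (Real.sqrt (4 * π * σ))⁻¹ ^ Module.finrank ℝ E * Real.exp (-‖x‖ ^ 2 / (8 * σ)) ≤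
        C / ρ ^ Module.finrank ℝ E := by
  set n := Module.finrank ℝ E with hn
  -- the square of the left-hand side is `(4πσ)^{-n} e^{-|x|²/(4σ)} ≤ (4/(πρ²))^n n!`
  refine ⟨Real.sqrt ((n.factorial : ℝ) * (4 / π) ^ n), Real.sqrt_nonneg _, ?_⟩
  intro σ ρ hσ hρ x hx
  have hpi : 0 < π := Real.pi_pos
  have h4 : 0 < 4 * π * σ := by positivity
  set L : ℝ := (Real.sqrt (4 * π * σ))⁻¹ ^ n * Real.exp (-‖x‖ ^ 2 / (8 * σ)) with hL
  have hL0 : 0 ≤ L := by positivity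
  -- `L² ≤ n! (4/π)^n / ρ^{2n}`
  have hsq : L ^ 2 ≤ (n.factorial : ℝ) * (4 / π) ^ n / (ρ ^ n) ^ 2 := by
    have hs2 : (Real.sqrt (4 * π * σ))⁻¹ ^ 2 = (4 * π * σ)⁻¹ := by
      rw [inv_pow, Real.sq_sqrt h4.le]
    have he2 : Real.exp (-‖x‖ ^ 2 / (8 * σ)) ^ 2 = Real.exp (-‖x‖ ^ 2 / (4 * σ)) := by
      rw [← Real.exp_nat_mul]
      congr 1
      push_cast
      field_simp
      ring
    have hL2 : L ^ 2 = ((4 * π * σ)⁻¹) ^ n * Real.exp (-‖x‖ ^ 2 / (4 * σ)) := by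
      rw [hL, mul_pow, ← he2, ← hs2, ← pow_mul, ← pow_mul, mul_comm n 2]
    rw [hL2]
    -- `e^{-|x|²/(4σ)} ≤ e^{-ρ²/(16σ)}`
    have hx2 : ρ ^ 2 / 4 ≤ ‖x‖ ^ 2 := by nlinarith [norm_nonneg x]
    set u : ℝ := ρ ^ 2 / (16 * σ) with hu
    have hu0 : 0 ≤ u := by positivity
    have hexp : Real.exp (-‖x‖ ^ 2 / (4 * σ)) ≤ Real.exp (-u) := by
      rw [Real.exp_le_exp, hu, neg_div, neg_le_neg_iff,
        div_le_div_iff₀ (by positivity) (by positivity)]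
      nlinarith
    -- `u^n e^{-u} ≤ n!`
    have hfac := pow_mul_exp_neg_le_factorial' hu0 n
    have hkey : (4 * π * σ)⁻¹ = 4 / (π * ρ ^ 2) * u := by
      rw [hu]; field_simp; ring
    calc ((4 * π * σ)⁻¹) ^ n * Real.exp (-‖x‖ ^ 2 / (4 * σ))
        ≤ ((4 * π * σ)⁻¹) ^ n * Real.exp (-u) := by gcongr
      _ = (4 / (π * ρ ^ 2)) ^ n * (u ^ n * Real.exp (-u)) := by rw [hkey, mul_pow]; ring
      _ ≤ (4 / (π * ρ ^ 2)) ^ n * (n.factorial : ℝ) := by gcongr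
      _ = (n.factorial : ℝ) * (4 / π) ^ n / (ρ ^ n) ^ 2 := by
        rw [← pow_mul, mul_comm n 2, pow_mul, div_pow, mul_pow, div_pow]
        field_simp
  have hρn : 0 < ρ ^ n := pow_pos hρ n
  calc L = Real.sqrt (L ^ 2) := (Real.sqrt_sq hL0).symm
    _ ≤ Real.sqrt ((n.factorial : ℝ) * (4 / π) ^ n / (ρ ^ n) ^ 2) := Real.sqrt_le_sqrt hsq
    _ = Real.sqrt ((n.factorial : ℝ) * (4 / π) ^ n) / ρ ^ n := by
      rw [Real.sqrt_div (by positivity), Real.sqrt_sq hρn.le]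

omit [FiniteDimensional ℝ E] [MeasurableSpace E] [BorelSpace E] in
/-- **Off-diagonal bound for the heat kernel**: `G_σ(x) ≤ C ρ^{-n}` for `|x| ≥ ρ/2`, uniformly in
`σ > 0`. [folklore] -/
theorem exists_heatKernel_le_of_le_norm :
    ∃ C : ℝ, 0 ≤ C ∧ ∀ {σ ρ : ℝ}, 0 < σ → 0 < ρ → ∀ x : E, ρ / 2 ≤ ‖x‖ →
      heatKernel σ x ≤ C / ρ ^ Module.finrank ℝ E := by
  obtain ⟨C, hC0, hC⟩ := exists_inv_sqrt_pow_mul_exp_le (E := E)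
  refine ⟨C, hC0, fun {σ ρ} hσ hρ x hx => ?_⟩
  rw [heatKernel_eq_inv_sqrt_pow hσ]
  have hsplit : Real.exp (-‖x‖ ^ 2 / (4 * σ)) =
      Real.exp (-‖x‖ ^ 2 / (8 * σ)) * Real.exp (-‖x‖ ^ 2 / (8 * σ)) := by
    rw [← Real.exp_add]; congr 1; field_simp; ring
  rw [hsplit, ← mul_assoc]
  calc _ ≤ C / ρ ^ Module.finrank ℝ E * Real.exp (-‖x‖ ^ 2 / (8 * σ)) :=
        mul_le_mul_of_nonneg_right (hC hσ hρ x hx) (Real.exp_nonneg _)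
    _ ≤ C / ρ ^ Module.finrank ℝ E * 1 :=
        mul_le_mul_of_nonneg_left (exp_neg_sq_div_le_one x (by positivity))
          (div_nonneg hC0 (pow_nonneg hρ.le _))
    _ = _ := mul_one _

omit [FiniteDimensional ℝ E] [MeasurableSpace E] [BorelSpace E] in
/-- **Off-diagonal bound for the gradient weight of the heat kernel**:
`G_σ(x) |x|/(2σ) ≤ C ρ^{-n-1}` for `|x| ≥ ρ/2`, uniformly in `σ > 0`
(`|∇G_σ(x)| = G_σ(x)|x|/(2σ)`, `norm_fderiv_heatKernel`). [folklore] -/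
theorem exists_heatKernel_div_mul_norm_le_of_le_norm :
    ∃ C : ℝ, 0 ≤ C ∧ ∀ {σ ρ : ℝ}, 0 < σ → 0 < ρ → ∀ x : E, ρ / 2 ≤ ‖x‖ →
      heatKernel σ x / (2 * σ) * ‖x‖ ≤ C / ρ ^ (Module.finrank ℝ E + 1) := by
  obtain ⟨C, hC0, hC⟩ := exists_inv_sqrt_pow_mul_exp_le (E := E)
  refine ⟨C * 8, by positivity, fun {σ ρ} hσ hρ x hx => ?_⟩
  rw [heatKernel_eq_inv_sqrt_pow hσ]
  have hxpos : 0 < ‖x‖ := lt_of_lt_of_le (by positivity) hx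
  have hsplit : Real.exp (-‖x‖ ^ 2 / (4 * σ)) =
      Real.exp (-‖x‖ ^ 2 / (8 * σ)) * Real.exp (-‖x‖ ^ 2 / (8 * σ)) := by
    rw [← Real.exp_add]; congr 1; field_simp; ring
  -- `(|x|/(2σ)) e^{-|x|²/(8σ)} = (4/|x|) · (v e^{-v})`, `v = |x|²/(8σ)`, and `v e^{-v} ≤ 1`
  set v : ℝ := ‖x‖ ^ 2 / (8 * σ) with hv
  have hv0 : 0 ≤ v := by positivity
  have hve : v * Real.exp (-v) ≤ 1 := by
    have := pow_mul_exp_neg_le_factorial' hv0 1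
    simpa using this
  have hsecond : Real.exp (-‖x‖ ^ 2 / (8 * σ)) / (2 * σ) * ‖x‖ ≤ 8 / ρ := by
    have heq : Real.exp (-‖x‖ ^ 2 / (8 * σ)) / (2 * σ) * ‖x‖ = 4 / ‖x‖ * (v * Real.exp (-v)) := by
      rw [hv, neg_div]; field_simp; ring
    rw [heq]
    calc 4 / ‖x‖ * (v * Real.exp (-v)) ≤ 4 / ‖x‖ * 1 := by gcongr
      _ = 4 / ‖x‖ := mul_one _
      _ ≤ 4 / (ρ / 2) := by gcongr
      _ = 8 / ρ := by ring
  have hfirst := hC hσ hρ x hx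
  have hρn : 0 < ρ ^ Module.finrank ℝ E := pow_pos hρ _
  calc (Real.sqrt (4 * π * σ))⁻¹ ^ Module.finrank ℝ E * Real.exp (-‖x‖ ^ 2 / (4 * σ)) / (2 * σ) * ‖x‖
      = ((Real.sqrt (4 * π * σ))⁻¹ ^ Module.finrank ℝ E * Real.exp (-‖x‖ ^ 2 / (8 * σ))) *
          (Real.exp (-‖x‖ ^ 2 / (8 * σ)) / (2 * σ) * ‖x‖) := by rw [hsplit]; ring
    _ ≤ C / ρ ^ Module.finrank ℝ E * (8 / ρ) :=
        mul_le_mul hfirst hsecond (by positivity) (div_nonneg hC0 hρn.le)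
    _ = C * 8 / ρ ^ (Module.finrank ℝ E + 1) := by rw [pow_succ]; field_simp

omit [FiniteDimensional ℝ E] [MeasurableSpace E] [BorelSpace E] in
/-- **On-diagonal bound after a time lag**: for `σ ≥ ρ²/4 > 0`,
`G_σ(x) ≤ (√π ρ)^{-n}`. [folklore] -/
theorem heatKernel_le_of_sq_le {σ ρ : ℝ} (hρ : 0 < ρ) (hσ : ρ ^ 2 / 4 ≤ σ) (x : E) :
    heatKernel σ x ≤ (Real.sqrt π)⁻¹ ^ Module.finrank ℝ E / ρ ^ Module.finrank ℝ E := by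
  have hσ0 : 0 < σ := lt_of_lt_of_le (by positivity) hσ
  have hpi : 0 < π := Real.pi_pos
  rw [heatKernel_eq_inv_sqrt_pow hσ0, ← div_pow]
  have hsq : Real.sqrt π * ρ ≤ Real.sqrt (4 * π * σ) := by
    rw [show Real.sqrt π * ρ = Real.sqrt (π * ρ ^ 2) by
      rw [Real.sqrt_mul hpi.le, Real.sqrt_sq hρ.le]]
    exact Real.sqrt_le_sqrt (by nlinarith)
  have h1 : (Real.sqrt (4 * π * σ))⁻¹ ≤ (Real.sqrt π)⁻¹ / ρ := by
    rw [div_eq_mul_inv, ← mul_inv]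
    exact inv_anti₀ (by positivity) hsq
  calc (Real.sqrt (4 * π * σ))⁻¹ ^ Module.finrank ℝ E * Real.exp (-‖x‖ ^ 2 / (4 * σ))
      ≤ ((Real.sqrt π)⁻¹ / ρ) ^ Module.finrank ℝ E * 1 := by
        exact mul_le_mul (pow_le_pow_left₀ (by positivity) h1 _)
          (exp_neg_sq_div_le_one x (by positivity)) (Real.exp_nonneg _) (by positivity)
    _ = _ := mul_one _

/-! ### Duhamel's formula for a smooth compactly supported space-time function -/

section Duhamel

variable {F : Type*} [NormedAddCommGroup F] [NormedSpace ℝ F]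

omit [FiniteDimensional ℝ E] [MeasurableSpace E] [BorelSpace E] in
/-- Slices of a smooth space-time function: the iterated space derivatives of `z ↦ U(τ, z)` are
the iterated derivatives of `U` composed with the inclusion `z ↦ (0, z)`. [folklore] -/
theorem iteratedFDeriv_timeSlice_eq_compCLM {U : ℝ × E → F} {n : WithTop ℕ∞} (hU : ContDiff ℝ n U)
    (τ : ℝ) (z : E) {i : ℕ} (hi : (i : WithTop ℕ∞) ≤ n) :
    iteratedFDeriv ℝ i (fun z' => U (τ, z')) z =
      (iteratedFDeriv ℝ i U (τ, z)).compContinuousLinearMap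
        fun _ => ContinuousLinearMap.inr ℝ ℝ E := by
  have h1 : (fun z' => U (τ, z')) =
      (fun p : ℝ × E => U (p + ((τ : ℝ), (0 : E)))) ∘ (ContinuousLinearMap.inr ℝ ℝ E) := by
    ext z'; simp
  have hf : ContDiff ℝ n (fun p : ℝ × E => U (p + ((τ : ℝ), (0 : E)))) :=
    hU.comp (contDiff_id.add contDiff_const)
  rw [h1, ContinuousLinearMap.iteratedFDeriv_comp_right _ hf z hi, iteratedFDeriv_comp_add_right]
  simp

omit [FiniteDimensional ℝ E] [MeasurableSpace E] [BorelSpace E] in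
/-- Norm bound for the slices: `‖D_z^i U(τ, ·)(z)‖ ≤ ‖D^i U(τ, z)‖`. [folklore] -/
theorem norm_iteratedFDeriv_timeSlice_le {U : ℝ × E → F} {n : WithTop ℕ∞} (hU : ContDiff ℝ n U)
    (τ : ℝ) (z : E) {i : ℕ} (hi : (i : WithTop ℕ∞) ≤ n) :
    ‖iteratedFDeriv ℝ i (fun z' => U (τ, z')) z‖ ≤ ‖iteratedFDeriv ℝ i U (τ, z)‖ := by
  rw [iteratedFDeriv_timeSlice_eq_compCLM hU τ z hi]
  refine (ContinuousMultilinearMap.norm_compContinuousLinearMap_le _ _).trans ?_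
  refine mul_le_of_le_one_right (norm_nonneg _) (Finset.prod_le_one (fun _ _ => norm_nonneg _)
    fun _ _ => ContinuousLinearMap.norm_inr_le_one ℝ ℝ E)

omit [FiniteDimensional ℝ E] [MeasurableSpace E] [BorelSpace E] in
/-- Second space derivatives of a slice in terms of `D²U`:
`D_z²U(τ,·)(z)(v, v') = D²U(τ,z)((0,v),(0,v'))`. [folklore] -/
theorem iteratedFDeriv_two_timeSlice_apply {U : ℝ × E → F} {n : WithTop ℕ∞} (hU : ContDiff ℝ n U)
    (hn : (2 : WithTop ℕ∞) ≤ n) (τ : ℝ) (z v v' : E) :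
    iteratedFDeriv ℝ 2 (fun z' => U (τ, z')) z ![v, v'] =
      iteratedFDeriv ℝ 2 U (τ, z) ![((0 : ℝ), v), ((0 : ℝ), v')] := by
  rw [iteratedFDeriv_timeSlice_eq_compCLM hU τ z (i := 2) (by exact_mod_cast hn),
    ContinuousMultilinearMap.compContinuousLinearMap_apply]
  congr 1
  ext i <;> fin_cases i <;> simp

omit [InnerProductSpace ℝ E] [FiniteDimensional ℝ E] [MeasurableSpace E] [BorelSpace E] in
/-- **Lipschitz continuity in time from a bounded time derivative** (mean value inequality along
`σ ↦ (σ, z)`). [folklore] -/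
theorem norm_sub_le_mul_abs_of_hasDerivAt_time [NormedSpace ℝ E] {G : Type*}
    [NormedAddCommGroup G] [NormedSpace ℝ G] {Φ Φ' : ℝ × E → G} {L : ℝ}
    (hΦ : ∀ τ z, HasDerivAt (fun σ => Φ (σ, z)) (Φ' (τ, z)) τ) (hL : ∀ p, ‖Φ' p‖ ≤ L)
    (τ τ' : ℝ) (z : E) : ‖Φ (τ', z) - Φ (τ, z)‖ ≤ L * |τ' - τ| := by
  have h := Convex.norm_image_sub_le_of_norm_hasDerivWithin_le (f := fun σ => Φ (σ, z))
    (f' := fun σ => Φ' (σ, z)) (s := univ) (fun x _ => (hΦ x z).hasDerivWithinAt)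
    (fun x _ => hL _) convex_univ (mem_univ τ) (mem_univ τ')
  simpa [Real.norm_eq_abs] using h

omit [InnerProductSpace ℝ E] [FiniteDimensional ℝ E] [MeasurableSpace E] [BorelSpace E] in
/-- The curve `σ ↦ (σ, z)` has velocity `(1, 0)`. [folklore] -/
private theorem hasDerivAt_prodMk_time [NormedSpace ℝ E] (τ : ℝ) (z : E) :
    HasDerivAt (fun σ : ℝ => ((σ, z) : ℝ × E)) ((1 : ℝ), (0 : E)) τ :=
  (hasDerivAt_id τ).prodMk (hasDerivAt_const τ z)

omit [InnerProductSpace ℝ E] [FiniteDimensional ℝ E] [MeasurableSpace E] [BorelSpace E] in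
/-- `‖(1, 0)‖ = 1` in `ℝ × E` (sup norm). [folklore] -/
private theorem norm_one_zero [NormedSpace ℝ E] : ‖((1 : ℝ), (0 : E))‖ = 1 := by
  simp [Prod.norm_def]

omit [InnerProductSpace ℝ E] [FiniteDimensional ℝ E] [MeasurableSpace E] [BorelSpace E] in
/-- `‖(0, v)‖ ≤ ‖v‖` in `ℝ × E` (sup norm). [folklore] -/
private theorem norm_zero_prod_le [NormedSpace ℝ E] (v : E) : ‖((0 : ℝ), v)‖ ≤ ‖v‖ := by
  simp [Prod.norm_def]

variable [CompleteSpace F]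

/-- **Duhamel's formula for a smooth compactly supported space-time function.** If
`U : ℝ × E → F` is smooth with compact support and `U(s, ·) = 0`, then for `s < t`
`U(t, y) = ∫ₛᵗ e^{(t-τ)Δ}(∂_τU − Δ_zU)(τ, ·)(y) dτ`
(the tree's Duhamel formula `HeatFlow.eq_heatExtension_add_integral`, all of whose elementary
bounds hold by continuity and compact support). [cite: Evans2010, §2.3.1 Theorem 2 / (c)] -/
theorem eq_intervalIntegral_heatExtension_of_contDiff {U : ℝ × E → F} (hU : ContDiff ℝ ∞ U)
    (hsupp : HasCompactSupport U) {s t : ℝ} (hst : s < t) (hs : ∀ z, U (s, z) = 0) (y : E) :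
    U (t, y) = ∫ τ in s..t, heatExtension
      (fun z => fderiv ℝ U (τ, z) (1, 0) - (Δ fun z' => U (τ, z')) z) (t - τ) y := by
  have htop : ∀ k : ℕ, (k : WithTop ℕ∞) ≤ ∞ := fun k => by exact_mod_cast le_top
  set u : ℝ → E → F := fun τ z => U (τ, z) with hu_def
  set v₀ : ℝ × E := ((1 : ℝ), (0 : E)) with hv₀
  set du : ℝ → E → F := fun τ z => fderiv ℝ U (τ, z) v₀ with hdu_def
  -- ### smoothness of the derivatives of `U`
  have hU1 : ContDiff ℝ ∞ (fderiv ℝ U) := hU.fderiv_right (m := ∞) (by norm_cast)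
  have hU2c : Continuous (iteratedFDeriv ℝ 2 U) := hU.continuous_iteratedFDeriv (htop 2)
  have hU3c : Continuous (iteratedFDeriv ℝ 3 U) := hU.continuous_iteratedFDeriv (htop 3)
  have hdiffU : Differentiable ℝ U := hU.differentiable (by simp)
  have hdiffU1 : Differentiable ℝ (fderiv ℝ U) := hU1.differentiable (by simp)
  have hdiffU2 : Differentiable ℝ (iteratedFDeriv ℝ 2 U) :=
    (hU.of_le (htop 3)).differentiable_iteratedFDeriv (m := 2)
      (by exact_mod_cast Nat.lt_succ_self 2)
  -- ### global bounds (continuity + compact support)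
  obtain ⟨B, hB⟩ := hU.continuous.bounded_above_of_compact_support hsupp
  obtain ⟨B₁, hB₁⟩ := (hU.continuous_fderiv (by simp)).bounded_above_of_compact_support
    (hsupp.fderiv (𝕜 := ℝ))
  -- the `F`-valued time derivative `p ↦ DU(p)(1, 0)` (avoids nested operator spaces)
  have hΦc : ContDiff ℝ ∞ (fun p : ℝ × E => fderiv ℝ U p v₀) := hU1.clm_apply contDiff_const
  have hΦsupp : HasCompactSupport (fun p : ℝ × E => fderiv ℝ U p v₀) :=
    hsupp.fderiv_apply (𝕜 := ℝ) v₀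
  have hdiffΦ : Differentiable ℝ (fun p : ℝ × E => fderiv ℝ U p v₀) :=
    hΦc.differentiable (by simp)
  obtain ⟨B₁₁, hB₁₁⟩ := (hΦc.continuous_fderiv (by simp)).bounded_above_of_compact_support
    (hΦsupp.fderiv (𝕜 := ℝ))
  obtain ⟨B₂, hB₂⟩ := hU2c.bounded_above_of_compact_support (hsupp.iteratedFDeriv 2)
  obtain ⟨B₃, hB₃⟩ := hU3c.bounded_above_of_compact_support (hsupp.iteratedFDeriv 3)
  have hB1nn : 0 ≤ B₁ := (norm_nonneg _).trans (hB₁ (s, y))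
  have hB11nn : 0 ≤ B₁₁ := (norm_nonneg _).trans (hB₁₁ (s, y))
  have hB2nn : 0 ≤ B₂ := (norm_nonneg _).trans (hB₂ (s, y))
  have hB3nn : 0 ≤ B₃ := (norm_nonneg _).trans (hB₃ (s, y))
  -- ### slices
  have hslice : ∀ τ, ContDiff ℝ ∞ (u τ) := fun τ => hU.comp (contDiff_prodMk_right τ)
  have hC2 : ∀ τ, ContDiff ℝ 2 (u τ) := fun τ => (hslice τ).of_le (htop 2)
  have hfd : ∀ τ z, fderiv ℝ (u τ) z = (fderiv ℝ U (τ, z)).comp (ContinuousLinearMap.inr ℝ ℝ E) :=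
    fun τ z => ((hdiffU (τ, z)).hasFDerivAt.comp z (hasFDerivAt_prodMk_right τ z)).fderiv
  have hu1 : ∀ τ z, ‖fderiv ℝ (u τ) z‖ ≤ B₁ := fun τ z => by
    rw [hfd]
    refine (ContinuousLinearMap.opNorm_comp_le _ _).trans ?_
    calc ‖fderiv ℝ U (τ, z)‖ * ‖ContinuousLinearMap.inr ℝ ℝ E‖ ≤ B₁ * 1 :=
          mul_le_mul (hB₁ _) (ContinuousLinearMap.norm_inr_le_one ℝ ℝ E)
            (norm_nonneg (ContinuousLinearMap.inr ℝ ℝ E)) hB1nn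
      _ = B₁ := mul_one _
  have hu2 : ∀ τ z, ‖fderiv ℝ (fderiv ℝ (u τ)) z‖ ≤ B₂ := fun τ z => by
    have h := norm_iteratedFDeriv_timeSlice_le hU τ z (htop 2)
    have heq : ‖iteratedFDeriv ℝ 2 (u τ) z‖ = ‖fderiv ℝ (fderiv ℝ (u τ)) z‖ := by
      rw [← norm_iteratedFDeriv_fderiv (n := 1), ← norm_iteratedFDeriv_fderiv (n := 0),
        norm_iteratedFDeriv_zero]
    exact heq ▸ h.trans (hB₂ _)
  -- ### the time derivative
  have hdu : ∀ τ z, HasDerivAt (fun σ => u σ z) (du τ z) τ := fun τ z =>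
    (hdiffU (τ, z)).hasFDerivAt.comp_hasDerivAt τ (hasDerivAt_prodMk_time τ z)
  have hduc : ∀ τ, Continuous (du τ) := fun τ =>
    ((hU.continuous_fderiv (by simp)).comp (Continuous.prodMk_right τ)).clm_apply
      continuous_const
  have hdu0 : ∀ τ z, ‖du τ z‖ ≤ B₁ := fun τ z => by
    calc ‖fderiv ℝ U (τ, z) v₀‖ ≤ ‖fderiv ℝ U (τ, z)‖ * ‖v₀‖ :=
          ContinuousLinearMap.le_opNorm _ _
      _ ≤ B₁ * 1 := mul_le_mul (hB₁ _) norm_one_zero.le (norm_nonneg _) hB1nn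
      _ = B₁ := mul_one _
  have hduL : ∀ τ τ' z, ‖du τ' z - du τ z‖ ≤ B₁₁ * |τ' - τ| := by
    intro τ τ' z
    refine norm_sub_le_mul_abs_of_hasDerivAt_time (Φ := fun p => fderiv ℝ U p v₀)
      (Φ' := fun p => fderiv ℝ (fun p' : ℝ × E => fderiv ℝ U p' v₀) p v₀) (fun σ z' => ?_)
      (fun p => ?_) τ τ' z
    · have h := (hdiffΦ (σ, z')).hasFDerivAt.comp_hasDerivAt σ (hasDerivAt_prodMk_time σ z')
      simpa [Function.comp_def] using h
    · calc ‖fderiv ℝ (fun p' : ℝ × E => fderiv ℝ U p' v₀) p v₀‖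
          ≤ ‖fderiv ℝ (fun p' : ℝ × E => fderiv ℝ U p' v₀) p‖ * ‖v₀‖ :=
            ContinuousLinearMap.le_opNorm _ _
        _ ≤ B₁₁ * 1 := mul_le_mul (hB₁₁ p) norm_one_zero.le (norm_nonneg _)
            ((norm_nonneg _).trans (hB₁₁ p))
        _ = B₁₁ := mul_one _
  -- ### the Laplacian of the slices
  set b := stdOrthonormalBasis ℝ E with hb_def
  set m₂ : Fin (Module.finrank ℝ E) → (Fin 2 → ℝ × E) := fun i => ![((0 : ℝ), b i), ((0 : ℝ), b i)]
    with hm₂_def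
  set G : ℝ × E → F := fun p => ∑ i, iteratedFDeriv ℝ 2 U p (m₂ i) with hG_def
  have hΔG : ∀ τ z, (Δ (u τ)) z = G (τ, z) := fun τ z => by
    rw [InnerProductSpace.laplacian_eq_iteratedFDeriv_orthonormalBasis (u τ) b]
    exact Finset.sum_congr rfl fun i _ => iteratedFDeriv_two_timeSlice_apply hU (htop 2) τ z _ _
  have hm₂n : ∀ i, ∏ j, ‖m₂ i j‖ ≤ 1 := fun i =>
    Finset.prod_le_one (fun _ _ => norm_nonneg _) fun j _ => by
      fin_cases j <;> simp [hm₂_def, Prod.norm_def]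
  have hGc : Continuous G :=
    continuous_finsetSum _ fun i _ => (continuous_eval_const (m₂ i)).comp hU2c
  have hΔc : ∀ τ, Continuous fun z => (Δ (u τ)) z := fun τ =>
    (hGc.comp (Continuous.prodMk_right τ)).congr fun z => (hΔG τ z).symm
  have hG0 : ∀ p, ‖G p‖ ≤ Module.finrank ℝ E * B₂ := fun p => by
    calc ‖G p‖ ≤ ∑ i, ‖iteratedFDeriv ℝ 2 U p (m₂ i)‖ := norm_sum_le _ _
      _ ≤ ∑ _i : Fin (Module.finrank ℝ E), B₂ := Finset.sum_le_sum fun i _ => by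
          calc ‖iteratedFDeriv ℝ 2 U p (m₂ i)‖
              ≤ ‖iteratedFDeriv ℝ 2 U p‖ * ∏ j, ‖m₂ i j‖ :=
                ContinuousMultilinearMap.le_opNorm _ _
            _ ≤ B₂ * 1 := mul_le_mul (hB₂ p) (hm₂n i) (by positivity) hB2nn
            _ = B₂ := mul_one _
      _ = Module.finrank ℝ E * B₂ := by simp
  have hΔ0 : ∀ τ z, ‖(Δ (u τ)) z‖ ≤ Module.finrank ℝ E * B₂ := fun τ z => by
    rw [hΔG]; exact hG0 _
  -- Lipschitz continuity of `G` in time, from `D³U`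
  set G' : ℝ × E → F := fun p => ∑ i, (fderiv ℝ (iteratedFDeriv ℝ 2 U) p (1, 0)) (m₂ i)
    with hG'_def
  have hGd : ∀ τ z, HasDerivAt (fun σ => G (σ, z)) (G' (τ, z)) τ := fun τ z => by
    have hsum := HasDerivAt.sum (u := Finset.univ)
      (A := fun i σ => iteratedFDeriv ℝ 2 U (σ, z) (m₂ i))
      (A' := fun i => (fderiv ℝ (iteratedFDeriv ℝ 2 U) (τ, z) (1, 0)) (m₂ i)) (x := τ)
      (fun i _ => ?_)
    · convert hsum using 1
      · funext σ; simp [hG_def]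
    · have h := (hdiffU2 (τ, z)).hasFDerivAt.comp_hasDerivAt τ (hasDerivAt_prodMk_time τ z)
      have h2 := (ContinuousMultilinearMap.apply ℝ (fun _ : Fin 2 => ℝ × E) F
        (m₂ i)).hasFDerivAt.comp_hasDerivAt τ h
      simpa [Function.comp_def] using h2
  have hG'0 : ∀ p, ‖G' p‖ ≤ Module.finrank ℝ E * B₃ := fun p => by
    calc ‖G' p‖ ≤ ∑ i, ‖(fderiv ℝ (iteratedFDeriv ℝ 2 U) p (1, 0)) (m₂ i)‖ := norm_sum_le _ _
      _ ≤ ∑ _i : Fin (Module.finrank ℝ E), B₃ := Finset.sum_le_sum fun i _ => by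
          calc ‖(fderiv ℝ (iteratedFDeriv ℝ 2 U) p (1, 0)) (m₂ i)‖
              ≤ ‖fderiv ℝ (iteratedFDeriv ℝ 2 U) p (1, 0)‖ * ∏ j, ‖m₂ i j‖ :=
                ContinuousMultilinearMap.le_opNorm _ _
            _ ≤ ‖fderiv ℝ (iteratedFDeriv ℝ 2 U) p‖ * ‖((1 : ℝ), (0 : E))‖ * 1 :=
                mul_le_mul (ContinuousLinearMap.le_opNorm _ _) (hm₂n i) (by positivity)
                  (by positivity)
            _ ≤ B₃ := by
                rw [norm_one_zero, mul_one, mul_one, norm_fderiv_iteratedFDeriv]; exact hB₃ p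
      _ = Module.finrank ℝ E * B₃ := by simp
  have hΔL : ∀ τ τ' z, ‖(Δ (u τ')) z - (Δ (u τ)) z‖ ≤ Module.finrank ℝ E * B₃ * |τ' - τ| :=
    fun τ τ' z => by
    rw [hΔG, hΔG]
    exact norm_sub_le_mul_abs_of_hasDerivAt_time hGd hG'0 τ τ' z
  -- ### Duhamel
  have key := HeatFlow.eq_heatExtension_add_integral (u := u) (du := du)
    (q := fun τ z => du τ z - (Δ (u τ)) z) (a := s - 1) (b := t + 1)
    hB11nn (by positivity) (fun τ _ => hC2 τ) (fun τ _ z => hB (τ, z)) (fun τ _ z => hu1 τ z)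
    (fun τ _ z => hu2 τ z) (fun τ _ z => hdu τ z) (fun τ _ => hduc τ) (fun τ _ z => hdu0 τ z)
    (fun τ _ τ' _ z => hduL τ τ' z) (fun τ _ => hΔc τ) (fun τ _ z => hΔ0 τ z)
    (fun τ _ τ' _ z => hΔL τ τ' z) (fun τ _ z => rfl) (by linarith) hst (by linarith) y
  have hus : u s = fun _ => (0 : F) := funext hs
  rw [hus, heatExtension_zero_fun, Pi.zero_apply, zero_add] at key
  simpa [hu_def, hdu_def] using key

end Duhamel

/-! ### Calculus at a fixed time -/

section FixedTime

variable {ι : Type*} [Fintype ι]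

omit [MeasurableSpace E] [BorelSpace E] in
/-- The Laplacian of a `C²` function as the sum of pure second partial derivatives over an
orthonormal basis (Mathlib's `laplacian_eq_iteratedFDeriv_orthonormalBasis`, with the
iterated derivative unfolded). [folklore] -/
theorem laplacian_apply_eq_sum_fderiv_fderiv {F : Type*} [NormedAddCommGroup F]
    [NormedSpace ℝ F] (b : OrthonormalBasis ι ℝ E) {f : E → F} (hf : ContDiff ℝ 2 f) (x : E) :
    (Δ f) x = ∑ i, fderiv ℝ (fun y => fderiv ℝ f y (b i)) x (b i) := by
  rw [InnerProductSpace.laplacian_eq_iteratedFDeriv_orthonormalBasis f b]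
  refine Finset.sum_congr rfl fun i _ => ?_
  have hd : DifferentiableAt ℝ (fderiv ℝ f) x :=
    ((hf.fderiv_right (m := 1) le_rfl).differentiable one_ne_zero) x
  rw [iteratedFDeriv_two_apply, fderiv_clm_apply hd (differentiableAt_const (b i))]
  simp

omit [FiniteDimensional ℝ E] [MeasurableSpace E] [BorelSpace E] in
/-- **Second-order product rule** for a pure second partial derivative of a product of two real
`C²` functions: `∂ᵥ∂ᵥ(φf) = φ ∂ᵥ∂ᵥf + 2 ∂ᵥφ ∂ᵥf + f ∂ᵥ∂ᵥφ`. [folklore] -/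
private theorem fderiv_fderiv_mul_apply_diag {φ f : E → ℝ} (hφ : ContDiff ℝ 2 φ) (hf : ContDiff ℝ 2 f)
    (z v : E) :
    fderiv ℝ (fun y => fderiv ℝ (fun x => φ x * f x) y v) z v =
      φ z * fderiv ℝ (fun y => fderiv ℝ f y v) z v +
        2 * (fderiv ℝ φ z v * fderiv ℝ f z v) + f z * fderiv ℝ (fun y => fderiv ℝ φ y v) z v := by
  have hφd : Differentiable ℝ φ := hφ.differentiable (by norm_num)
  have hfd : Differentiable ℝ f := hf.differentiable (by norm_num)
  have hφ1 : Differentiable ℝ fun y => fderiv ℝ φ y v :=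
    ((hφ.fderiv_right (m := 1) le_rfl).differentiable one_ne_zero).clm_apply
      (differentiable_const v)
  have hf1 : Differentiable ℝ fun y => fderiv ℝ f y v :=
    ((hf.fderiv_right (m := 1) le_rfl).differentiable one_ne_zero).clm_apply
      (differentiable_const v)
  -- first derivative of the product
  have h1 : (fun y => fderiv ℝ (fun x => φ x * f x) y v) =
      fun y => φ y * fderiv ℝ f y v + f y * fderiv ℝ φ y v := by
    funext y
    rw [fderiv_fun_mul (hφd y) (hfd y)]
    simp [smul_eq_mul]
  have h2 : HasFDerivAt (fun y => φ y * fderiv ℝ f y v + f y * fderiv ℝ φ y v)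
      (φ z • fderiv ℝ (fun y => fderiv ℝ f y v) z + fderiv ℝ f z v • fderiv ℝ φ z +
        (f z • fderiv ℝ (fun y => fderiv ℝ φ y v) z + fderiv ℝ φ z v • fderiv ℝ f z)) z :=
    ((hφd z).hasFDerivAt.mul (hf1 z).hasFDerivAt).add
      ((hfd z).hasFDerivAt.mul (hφ1 z).hasFDerivAt)
  rw [h1, h2.fderiv]
  simp only [_root_.add_apply, FunLike.coe_smul, Pi.smul_apply, smul_eq_mul]
  ring

omit [FiniteDimensional ℝ E] [MeasurableSpace E] [BorelSpace E] in
/-- The Laplacian of a constant multiple: `∑ᵢ ∂ᵢ∂ᵢ(a f) = a ∑ᵢ ∂ᵢ∂ᵢ f`. [folklore] -/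
theorem fderiv_fderiv_const_mul_apply {f : E → ℝ} (hf : ContDiff ℝ 2 f) (a : ℝ) (z v : E) :
    fderiv ℝ (fun y => fderiv ℝ (fun x => a * f x) y v) z v =
      a * fderiv ℝ (fun y => fderiv ℝ f y v) z v := by
  have hfd : Differentiable ℝ f := hf.differentiable (by norm_num)
  have hf1 : Differentiable ℝ fun y => fderiv ℝ f y v :=
    ((hf.fderiv_right (m := 1) le_rfl).differentiable one_ne_zero).clm_apply
      (differentiable_const v)
  have h1 : (fun y => fderiv ℝ (fun x => a * f x) y v) = fun y => a * fderiv ℝ f y v := by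
    funext y
    rw [fderiv_const_mul (hfd y)]
    simp [smul_eq_mul]
  rw [h1, fderiv_const_mul (hf1 z)]
  simp [smul_eq_mul]

/-- **Integration by parts against a compactly supported `C¹` weight**:
`∫ χ ∂ᵥF = −∫ (∂ᵥχ) F` for `χ ∈ C¹_c` and `F ∈ C¹`. [folklore] -/
theorem integral_mul_fderiv_apply_eq_neg {χ F : E → ℝ} (hχ : ContDiff ℝ 1 χ)
    (hχs : HasCompactSupport χ) (hF : ContDiff ℝ 1 F) (v : E) :
    ∫ z, χ z * fderiv ℝ F z v = -∫ z, fderiv ℝ χ z v * F z := by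
  have hχc : Continuous χ := hχ.continuous
  have hFc : Continuous F := hF.continuous
  have hχ1 : Continuous fun z => fderiv ℝ χ z v :=
    (hχ.continuous_fderiv one_ne_zero).clm_apply continuous_const
  have hF1 : Continuous fun z => fderiv ℝ F z v :=
    (hF.continuous_fderiv one_ne_zero).clm_apply continuous_const
  refine integral_mul_fderiv_eq_neg_fderiv_mul_of_integrable ?_ ?_ ?_
    (fun z _ => hχ.differentiable one_ne_zero z) (fun z _ => hF.differentiable one_ne_zero z)
  · exact (hχ1.mul hFc).integrable_of_hasCompactSupport ((hχs.fderiv_apply (𝕜 := ℝ) v).mul_right)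
  · exact (hχc.mul hF1).integrable_of_hasCompactSupport hχs.mul_right
  · exact (hχc.mul hFc).integrable_of_hasCompactSupport hχs.mul_right

omit [FiniteDimensional ℝ E] [MeasurableSpace E] [BorelSpace E] in
/-- The heat kernel is smooth in space. [folklore] -/
theorem contDiff_heatKernel' (t : ℝ) : ContDiff ℝ ∞ (heatKernel (E := E) t) := by
  unfold heatKernel
  exact contDiff_const.mul (((contDiff_norm_sq ℝ).neg.div_const _).exp)

omit [FiniteDimensional ℝ E] [MeasurableSpace E] [BorelSpace E] in
/-- The reflected kernel `z ↦ G_σ(y₀ − z)`: its derivative is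
`v ↦ (G_σ(y₀ − z)/(2σ)) ⟨y₀ − z, v⟩`. [folklore] -/
theorem hasFDerivAt_heatKernel_sub (σ : ℝ) (y₀ z : E) :
    HasFDerivAt (fun z' => heatKernel σ (y₀ - z'))
      ((heatKernel σ (y₀ - z) / (2 * σ)) • innerSL ℝ (y₀ - z)) z := by
  have h := (hasFDerivAt_heatKernel σ (y₀ - z)).comp z
    ((hasFDerivAt_const y₀ z).sub (hasFDerivAt_id z))
  refine h.congr_fderiv ?_
  ext v
  simp

omit [FiniteDimensional ℝ E] [MeasurableSpace E] [BorelSpace E] in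
/-- Bound for the derivative of the reflected kernel:
`|∂ᵥ[G_σ(y₀ − ·)](z)| ≤ G_σ(y₀ − z) |y₀ − z|/(2σ) · ‖v‖` (`σ > 0`). [folklore] -/
theorem abs_fderiv_heatKernel_sub_apply_le {σ : ℝ} (hσ : 0 < σ) (y₀ z v : E) :
    |fderiv ℝ (fun z' => heatKernel σ (y₀ - z')) z v| ≤
      heatKernel σ (y₀ - z) / (2 * σ) * ‖y₀ - z‖ * ‖v‖ := by
  rw [(hasFDerivAt_heatKernel_sub σ y₀ z).fderiv, FunLike.coe_smul, Pi.smul_apply,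
    innerSL_apply_apply, smul_eq_mul, abs_mul, abs_of_nonneg (div_nonneg (heatKernel_pos hσ _).le (by positivity)),
    mul_assoc]
  gcongr
  · exact div_nonneg (heatKernel_pos hσ _).le (by positivity)
  · exact abs_real_inner_le_norm _ _

omit [FiniteDimensional ℝ E] [MeasurableSpace E] [BorelSpace E] in
/-- Pure second partial derivatives vanish off the topological support. [folklore] -/
private theorem fderiv_fderiv_apply_eq_zero_of_notMem {φ : E → ℝ} {z : E} (hz : z ∉ tsupport φ)
    (v : E) : fderiv ℝ (fun y => fderiv ℝ φ y v) z v = 0 := by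
  have : (fun y => fderiv ℝ φ y v) =ᶠ[𝓝 z] fun _ => 0 := by
    filter_upwards [(isClosed_tsupport φ).isOpen_compl.mem_nhds hz] with y hy
    simp [fderiv_of_notMem_tsupport ℝ hy]
  rw [this.fderiv_eq]
  simp

/-- **The fixed-time estimate.** Let `φ ∈ C^∞_c(E)` be a nonnegative cut-off, `f ∈ C²(E)`,
`g ∈ C(E)` with `g ≤ ∑ᵢ ∂ᵢ∂ᵢ f` on `{φ ≠ 0}` (at a fixed time, `f = w(τ, ·)`, `g = ∂_τ w(τ, ·)`),
`a ≥ 0`, `a' ∈ ℝ` (the values of the time cut-off and of its derivative) and `σ > 0`. Then the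
heat-kernel average of the source `(∂_τ − Δ)(aφw) = a'φf + aφg − a∑ᵢ∂ᵢ∂ᵢ(φf)` is bounded by
an average of `f` against weights built from `φ`, `∇φ`, `Δφ`, the kernel and its gradient:
the term `aφ(g − Δf) G ≤ 0` is dropped and the cross term `−2aG⟨∇φ, ∇f⟩` is integrated by
parts onto `G∇φ`. [folklore] -/
theorem integral_heatKernel_mul_source_le (b : OrthonormalBasis ι ℝ E) {φ f g : E → ℝ}
    (hφ : ContDiff ℝ ∞ φ) (hφs : HasCompactSupport φ) (hφ0 : ∀ z, 0 ≤ φ z)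
    (hf : ContDiff ℝ 2 f) (hg : Continuous g)
    (hsub : ∀ z, φ z ≠ 0 → g z ≤ ∑ i, fderiv ℝ (fun y => fderiv ℝ f y (b i)) z (b i))
    {σ : ℝ} (hσ : 0 < σ) (y₀ : E) {a : ℝ} (ha : 0 ≤ a) (a' : ℝ) :
    ∫ z, heatKernel σ (y₀ - z) *
        (a' * (φ z * f z) + a * (φ z * g z) -
          a * ∑ i, fderiv ℝ (fun y => fderiv ℝ (fun x => φ x * f x) y (b i)) z (b i)) ≤
      ∫ z, f z * (a' * (heatKernel σ (y₀ - z) * φ z) +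
        a * (heatKernel σ (y₀ - z) * ∑ i, fderiv ℝ (fun y => fderiv ℝ φ y (b i)) z (b i)) +
        2 * a * ∑ i, fderiv ℝ (fun z' => heatKernel σ (y₀ - z')) z (b i) * fderiv ℝ φ z (b i)) := by
  -- ### notation
  set K : E → ℝ := fun z => heatKernel σ (y₀ - z) with hK
  set dφ : ι → E → ℝ := fun i z => fderiv ℝ φ z (b i) with hdφ
  set ddφ : ι → E → ℝ := fun i z => fderiv ℝ (fun y => fderiv ℝ φ y (b i)) z (b i) with hddφ
  set df : ι → E → ℝ := fun i z => fderiv ℝ f z (b i) with hdf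
  set ddf : ι → E → ℝ := fun i z => fderiv ℝ (fun y => fderiv ℝ f y (b i)) z (b i) with hddf
  set dK : ι → E → ℝ := fun i z => fderiv ℝ K z (b i) with hdK
  have htop : ∀ k : ℕ, (k : WithTop ℕ∞) ≤ ∞ := fun k => by exact_mod_cast le_top
  have hφ2 : ContDiff ℝ 2 φ := hφ.of_le (htop 2)
  have hKs : ContDiff ℝ ∞ K := (contDiff_heatKernel' σ).comp (contDiff_const.sub contDiff_id)
  -- ### continuity
  have hKc : Continuous K := hKs.continuous
  have hφc : Continuous φ := hφ.continuous
  have hfc : Continuous f := hf.continuous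
  have hd_cont : ∀ {F : E → ℝ}, ContDiff ℝ 2 F → ∀ i, Continuous (fun z => fderiv ℝ F z (b i)) ∧
      Continuous (fun z => fderiv ℝ (fun y => fderiv ℝ F y (b i)) z (b i)) := by
    intro F hF i
    have h1 : ContDiff ℝ 1 fun y => fderiv ℝ F y (b i) :=
      (hF.fderiv_right (m := 1) le_rfl).clm_apply contDiff_const
    exact ⟨h1.continuous, (h1.continuous_fderiv one_ne_zero).clm_apply continuous_const⟩
  have hdφc : ∀ i, Continuous (dφ i) := fun i => (hd_cont hφ2 i).1
  have hddφc : ∀ i, Continuous (ddφ i) := fun i => (hd_cont hφ2 i).2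
  have hdfc : ∀ i, Continuous (df i) := fun i => (hd_cont hf i).1
  have hddfc : ∀ i, Continuous (ddf i) := fun i => (hd_cont hf i).2
  have hK2 : ContDiff ℝ 2 K := hKs.of_le (htop 2)
  have hdKc : ∀ i, Continuous (dK i) := fun i => (hd_cont hK2 i).1
  -- ### vanishing off the support of `φ`
  set S := tsupport φ with hS
  have hSc : IsCompact S := hφs
  have hφS : ∀ z, z ∉ S → φ z = 0 := fun z hz => image_eq_zero_of_notMem_tsupport hz
  have hdφS : ∀ i z, z ∉ S → dφ i z = 0 := fun i z hz => by
    simp [hdφ, fderiv_of_notMem_tsupport ℝ hz]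
  have hddφS : ∀ i z, z ∉ S → ddφ i z = 0 := fun i z hz =>
    fderiv_fderiv_apply_eq_zero_of_notMem hz (b i)
  -- compactly supported continuous functions are integrable
  have hint : ∀ {F : E → ℝ}, Continuous F → (∀ z, z ∉ S → F z = 0) → Integrable F := fun hF hFS =>
    hF.integrable_of_hasCompactSupport (HasCompactSupport.intro hSc hFS)
  -- ### the three pieces of the source
  set P : E → ℝ := fun z => a * (K z * (φ z * (g z - ∑ i, ddf i z))) with hP
  set Q : E → ℝ := fun z => f z * (a' * (K z * φ z) - a * (K z * ∑ i, ddφ i z)) with hQ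
  set R : ι → E → ℝ := fun i z => (K z * dφ i z) * df i z with hR
  have hexp : ∀ z, ∑ i, fderiv ℝ (fun y => fderiv ℝ (fun x => φ x * f x) y (b i)) z (b i) =
      φ z * ∑ i, ddf i z + 2 * ∑ i, dφ i z * df i z + f z * ∑ i, ddφ i z := by
    intro z
    rw [Finset.mul_sum, Finset.mul_sum, Finset.mul_sum, ← Finset.sum_add_distrib,
      ← Finset.sum_add_distrib]
    exact Finset.sum_congr rfl fun i _ => by rw [fderiv_fderiv_mul_apply_diag hφ2 hf]
  have hpt : ∀ z, K z * (a' * (φ z * f z) + a * (φ z * g z) -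
      a * ∑ i, fderiv ℝ (fun y => fderiv ℝ (fun x => φ x * f x) y (b i)) z (b i)) =
      P z + Q z - 2 * a * ∑ i, R i z := by
    intro z
    have hR' : ∑ i, R i z = K z * ∑ i, dφ i z * df i z := by
      rw [Finset.mul_sum]
      exact Finset.sum_congr rfl fun i _ => by simp only [hR]; ring
    rw [hexp z, hR']
    simp only [hP, hQ]
    ring
  -- ### integrability of the pieces
  have hPc : Continuous P :=
    continuous_const.mul (hKc.mul (hφc.mul (hg.sub (continuous_finsetSum _ fun i _ => hddfc i))))
  have hPi : Integrable P := hint hPc fun z hz => by simp [hP, hφS z hz]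
  have hQc : Continuous Q :=
    hfc.mul ((continuous_const.mul (hKc.mul hφc)).sub
      (continuous_const.mul (hKc.mul (continuous_finsetSum _ fun i _ => hddφc i))))
  have hQi : Integrable Q := hint hQc fun z hz => by
    have h0 : ∀ i, ddφ i z = 0 := fun i => hddφS i z hz
    simp [hQ, hφS z hz, h0]
  have hRi : ∀ i, Integrable (R i) := fun i =>
    hint ((hKc.mul (hdφc i)).mul (hdfc i)) fun z hz => by simp [hR, hdφS i z hz]
  have hPQi : Integrable (fun z => P z + Q z) := hPi.add hQi
  have hRs : Integrable (fun z => ∑ i, R i z) := integrable_finsetSum _ fun i _ => hRi i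
  have hRsi : Integrable (fun z => 2 * a * ∑ i, R i z) := hRs.const_mul (2 * a)
  -- the integrated-by-parts pieces
  set T : ι → E → ℝ := fun i z => (K z * ddφ i z + dφ i z * dK i z) * f z with hT
  have hTc : ∀ i, Continuous (T i) := fun i =>
    ((hKc.mul (hddφc i)).add ((hdφc i).mul (hdKc i))).mul hfc
  have hTi : ∀ i, Integrable (T i) := fun i =>
    hint (hTc i) fun z hz => by simp [hT, hdφS i z hz, hddφS i z hz]
  -- ### integration by parts: `∫ (K ∂ᵢφ) ∂ᵢf = -∫ ∂ᵢ(K ∂ᵢφ) f`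
  have hKd : Differentiable ℝ K := hKs.differentiable (by simp)
  have hdφ_smooth : ∀ i, ContDiff ℝ ∞ (dφ i) := fun i =>
    (hφ.fderiv_right (m := ∞) (by norm_cast)).clm_apply contDiff_const
  have hdφd : ∀ i, Differentiable ℝ (dφ i) := fun i => (hdφ_smooth i).differentiable (by simp)
  have hIBP : ∀ i, ∫ z, R i z = -∫ z, T i z := by
    intro i
    have hχ : ContDiff ℝ 1 fun z => K z * dφ i z :=
      (hKs.mul (hdφ_smooth i)).of_le (htop 1)
    have hχs : HasCompactSupport fun z => K z * dφ i z :=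
      HasCompactSupport.intro hSc fun z hz => by simp [hdφS i z hz]
    have h := integral_mul_fderiv_apply_eq_neg hχ hχs (hf.of_le one_le_two) (b i)
    calc ∫ z, R i z = ∫ z, K z * dφ i z * fderiv ℝ f z (b i) := rfl
      _ = -∫ z, fderiv ℝ (fun z => K z * dφ i z) z (b i) * f z := h
      _ = -∫ z, T i z := by
        congr 1
        refine integral_congr_ae (Eventually.of_forall fun z => ?_)
        change fderiv ℝ (fun z => K z * dφ i z) z (b i) * f z = T i z
        rw [fderiv_fun_mul (hKd z) (hdφd i z)]
        simp only [hT, hddφ, hdK, hdφ, _root_.add_apply, FunLike.coe_smul, Pi.smul_apply,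
          smul_eq_mul]
  -- ### the sign of the transport term
  have hP0 : ∫ z, P z ≤ 0 := by
    refine integral_nonpos fun z => ?_
    by_cases hφz : φ z = 0
    · simp [hP, hφz]
    · exact mul_nonpos_of_nonneg_of_nonpos ha (mul_nonpos_of_nonneg_of_nonpos
        (heatKernel_pos hσ _).le (mul_nonpos_of_nonneg_of_nonpos (hφ0 z)
          (sub_nonpos.2 (hsub z hφz))))
  -- ### assembling
  have hLHS : ∫ z, K z * (a' * (φ z * f z) + a * (φ z * g z) -
      a * ∑ i, fderiv ℝ (fun y => fderiv ℝ (fun x => φ x * f x) y (b i)) z (b i)) =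
      ∫ z, (P z + Q z - 2 * a * ∑ i, R i z) :=
    integral_congr_ae (Eventually.of_forall hpt)
  have hRHS : ∫ z, f z * (a' * (K z * φ z) + a * (K z * ∑ i, ddφ i z) +
      2 * a * ∑ i, dK i z * dφ i z) = ∫ z, (Q z + 2 * a * ∑ i, T i z) := by
    refine integral_congr_ae (Eventually.of_forall fun z => ?_)
    simp only [hQ, hT, mul_add, mul_sub, Finset.mul_sum]
    rw [add_assoc, ← Finset.sum_add_distrib, sub_eq_add_neg, ← Finset.sum_neg_distrib, add_assoc,
      ← Finset.sum_add_distrib]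
    congr 1
    exact Finset.sum_congr rfl fun i _ => by ring
  have hTs : Integrable (fun z => ∑ i, T i z) := integrable_finsetSum _ fun i _ => hTi i
  have hTsi : Integrable (fun z => 2 * a * ∑ i, T i z) := hTs.const_mul (2 * a)
  have hsumR : ∑ i, ∫ z, R i z = -∑ i, ∫ z, T i z := by
    rw [← Finset.sum_neg_distrib]
    exact Finset.sum_congr rfl fun i _ => hIBP i
  have e1 : ∫ z, (P z + Q z - 2 * a * ∑ i, R i z) =
      (∫ z, P z) + (∫ z, Q z) - 2 * a * ∑ i, ∫ z, R i z := by
    rw [integral_sub hPQi hRsi, integral_add hPi hQi,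
      MeasureTheory.integral_const_mul (2 * a) (fun z => ∑ i, R i z),
      integral_finsetSum _ (fun i _ => hRi i)]
  have e2 : ∫ z, (Q z + 2 * a * ∑ i, T i z) = (∫ z, Q z) + 2 * a * ∑ i, ∫ z, T i z := by
    rw [integral_add hQi hTsi, MeasureTheory.integral_const_mul (2 * a) (fun z => ∑ i, T i z),
      integral_finsetSum _ (fun i _ => hTi i)]
  rw [hLHS, hRHS, e1, e2, hsumR]
  linarith

end FixedTime

/-! ### The mean-value inequality -/

section MeanValue

/-- A bound for the derivative of `Real.smoothTransition` (continuous, vanishing off `[0,1]`).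
[folklore] -/
private theorem exists_abs_deriv_smoothTransition_le_const :
    ∃ M : ℝ, 0 ≤ M ∧ ∀ x, |deriv Real.smoothTransition x| ≤ M := by
  have hderiv0 : ∀ {x : ℝ}, x ∉ Icc (0 : ℝ) 1 → deriv Real.smoothTransition x = 0 := by
    intro x hx
    rcases lt_or_gt_of_ne (fun h : x = 0 => hx ⟨h.ge, by rw [h]; exact zero_le_one⟩) with h0 | h0
    · have hev : Real.smoothTransition =ᶠ[𝓝 x] fun _ => (0 : ℝ) := by
        filter_upwards [(isOpen_gt' (0 : ℝ)).mem_nhds h0] with z hz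
        exact Real.smoothTransition.zero_of_nonpos (le_of_lt hz)
      rw [hev.deriv_eq]
      exact deriv_const x 0
    · have h1 : 1 < x := by
        by_contra h
        exact hx ⟨h0.le, not_lt.mp h⟩
      have hev : Real.smoothTransition =ᶠ[𝓝 x] fun _ => (1 : ℝ) := by
        filter_upwards [(isOpen_lt' (1 : ℝ)).mem_nhds h1] with z hz
        exact Real.smoothTransition.one_of_one_le (le_of_lt hz)
      rw [hev.deriv_eq]
      exact deriv_const x 1
  have hcont : Continuous (deriv Real.smoothTransition) :=
    (Real.smoothTransition.contDiff (n := 1)).continuous_deriv le_rfl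
  obtain ⟨M, hM⟩ := isCompact_Icc.exists_bound_of_continuousOn (s := Icc (0 : ℝ) 1)
    hcont.continuousOn
  refine ⟨max M 0, le_max_right _ _, fun x => ?_⟩
  by_cases hx : x ∈ Icc (0 : ℝ) 1
  · exact ((Real.norm_eq_abs _).symm.le.trans (hM x hx)).trans (le_max_left _ _)
  · rw [hderiv0 hx, abs_zero]
    exact le_max_right _ _

/-- The scaled transition `τ ↦ smoothTransition (k (τ − c))` (`k > 0`): smooth, valued in `[0,1]`,
`= 0` for `τ ≤ c`, `= 1` for `c + 1/k ≤ τ`, with `|derivative| ≤ M k` everywhere and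
derivative `0` for `τ > c + 1/k`. [folklore] -/
private theorem scaledTransition_props {M : ℝ} (hM : ∀ x, |deriv Real.smoothTransition x| ≤ M)
    {k : ℝ} (hk : 0 < k) (c : ℝ) :
    ContDiff ℝ ∞ (fun τ => Real.smoothTransition (k * (τ - c))) ∧
    (∀ τ, 0 ≤ Real.smoothTransition (k * (τ - c))) ∧
    (∀ τ, Real.smoothTransition (k * (τ - c)) ≤ 1) ∧
    (∀ τ, τ ≤ c → Real.smoothTransition (k * (τ - c)) = 0) ∧
    (∀ τ, c + 1 / k ≤ τ → Real.smoothTransition (k * (τ - c)) = 1) ∧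
    (∀ τ, |deriv (fun τ => Real.smoothTransition (k * (τ - c))) τ| ≤ M * k) ∧
    (∀ τ, c + 1 / k < τ → deriv (fun τ => Real.smoothTransition (k * (τ - c))) τ = 0) := by
  have hsm : ContDiff ℝ ∞ (fun τ => Real.smoothTransition (k * (τ - c))) :=
    Real.smoothTransition.contDiff.comp (contDiff_const.mul (contDiff_id.sub contDiff_const))
  have hone : ∀ τ, c + 1 / k ≤ τ → Real.smoothTransition (k * (τ - c)) = 1 := fun τ hτ => by
    refine Real.smoothTransition.one_of_one_le ?_
    have : 1 / k ≤ τ - c := by linarith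
    calc (1 : ℝ) = k * (1 / k) := by field_simp
      _ ≤ k * (τ - c) := by gcongr
  refine ⟨hsm, fun τ => Real.smoothTransition.nonneg _, fun τ => Real.smoothTransition.le_one _,
    fun τ hτ => Real.smoothTransition.zero_of_nonpos (mul_nonpos_of_nonneg_of_nonpos hk.le
      (sub_nonpos.2 hτ)), hone, fun τ => ?_, fun τ hτ => ?_⟩
  · have hinner : HasDerivAt (fun τ => k * (τ - c)) (k * 1) τ :=
      ((hasDerivAt_id τ).sub_const c).const_mul k
    have houter : HasDerivAt Real.smoothTransition
        (deriv Real.smoothTransition (k * (τ - c))) (k * (τ - c)) :=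
      ((Real.smoothTransition.contDiff (n := 1)).differentiable (by simp) _).hasDerivAt
    have hcomp := houter.comp τ hinner
    change |deriv (Real.smoothTransition ∘ fun τ => k * (τ - c)) τ| ≤ M * k
    rw [hcomp.deriv, abs_mul, mul_one, abs_of_pos hk]
    exact mul_le_mul_of_nonneg_right (hM _) hk.le
  · have hev : (fun τ => Real.smoothTransition (k * (τ - c))) =ᶠ[𝓝 τ] fun _ => (1 : ℝ) := by
      filter_upwards [(isOpen_lt' (c + 1 / k)).mem_nhds hτ] with σ hσ
      exact hone σ hσ.le
    rw [hev.deriv_eq]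
    exact deriv_const τ 1

omit [FiniteDimensional ℝ E] [MeasurableSpace E] [BorelSpace E] in
/-- Pure second derivatives of a `C²` function as values of `iteratedFDeriv ℝ 2`. [folklore] -/
private theorem fderiv_fderiv_apply_eq_iteratedFDeriv_two' {F : Type*} [NormedAddCommGroup F]
    [NormedSpace ℝ F] {f : E → F} (hf : ContDiff ℝ 2 f) (x v : E) :
    fderiv ℝ (fun y => fderiv ℝ f y v) x v = iteratedFDeriv ℝ 2 f x ![v, v] := by
  have hd : DifferentiableAt ℝ (fderiv ℝ f) x :=
    ((hf.fderiv_right (m := 1) le_rfl).differentiable one_ne_zero) x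
  rw [iteratedFDeriv_two_apply, fderiv_clm_apply hd (differentiableAt_const v)]
  simp

/-- **The parabolic mean-value inequality for smooth nonnegative subsolutions of the heat
equation.** There is a constant `C = C(E) > 0` such that for every `w`, jointly smooth on
`𝒯 × E` (`𝒯 ⊆ ℝ` open), every `ρ > 0` and every cylinder `[t₀ − ρ², t₀] × B̄_ρ(y₀)` with
`[t₀ − ρ², t₀] ⊆ 𝒯` on which `w ≥ 0` and `∂ₜw ≤ Δw`,
`w(t₀, y₀) ≤ C ρ^{-(n+2)} ∫_{t₀-ρ²}^{t₀} ∫_{B̄_ρ(y₀)} w` (`n = dim E`). This is the case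
`m = 1` (resp. `p = 1`, `f = 0`) of Lieberman's local supremum estimate / local maximum principle
for the heat operator, for smooth nonnegative subsolutions, evaluated at the top centre of the
cylinder. [cite: Lieberman1996, Thm. 6.17 (m = 1) and Thm. 7.36 (p = 1, f = 0)] -/
theorem le_mul_integral_of_heat_subsolution :
    ∃ C : ℝ, 0 < C ∧ ∀ {w : ℝ → E → ℝ} {𝒯 : Set ℝ}, IsOpen 𝒯 →
      ContDiffOn ℝ ∞ (fun p : ℝ × E => w p.1 p.2) (𝒯 ×ˢ (univ : Set E)) →
      ∀ {t₀ : ℝ} {y₀ : E} {ρ : ℝ}, 0 < ρ → Icc (t₀ - ρ ^ 2) t₀ ⊆ 𝒯 →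
      (∀ t ∈ Icc (t₀ - ρ ^ 2) t₀, ∀ y ∈ closedBall y₀ ρ, 0 ≤ w t y) →
      (∀ t ∈ Icc (t₀ - ρ ^ 2) t₀, ∀ y ∈ closedBall y₀ ρ,
          deriv (fun s => w s y) t ≤ (Δ (w t)) y) →
      w t₀ y₀ ≤ C / ρ ^ (Module.finrank ℝ E + 2) *
        ∫ t in (t₀ - ρ ^ 2)..t₀, ∫ y in closedBall y₀ ρ, w t y := by
  classical
  set n := Module.finrank ℝ E with hn
  -- ### universal constants
  obtain ⟨φf, Cφ, hCφ0, hφf⟩ := Calculus.exists_smooth_cutoff_family (E := E)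
  obtain ⟨M₁, hM₁0, hM₁⟩ := exists_abs_deriv_smoothTransition_le_const
  obtain ⟨CK, hCK0, hCK⟩ := exists_heatKernel_le_of_le_norm (E := E)
  obtain ⟨CG, hCG0, hCG⟩ := exists_heatKernel_div_mul_norm_le_of_le_norm (E := E)
  set Cπ : ℝ := (Real.sqrt π)⁻¹ ^ n with hCπ
  have hCπ0 : 0 ≤ Cπ := by positivity
  set C' : ℝ := 2 * M₁ * Cπ + 4 * n * Cφ 2 * CK + 4 * n * Cφ 1 * CG with hC'
  have hC'0 : 0 ≤ C' := by
    have := hCφ0 1; have := hCφ0 2; positivity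
  refine ⟨C' + 1, by positivity, ?_⟩
  intro w 𝒯 h𝒯 hw t₀ y₀ ρ hρ hI hw0 hsub
  set b := stdOrthonormalBasis ℝ E with hb_def
  set W : ℝ × E → ℝ := fun p => w p.1 p.2 with hW
  have hO : IsOpen (𝒯 ×ˢ (univ : Set E)) := h𝒯.prod isOpen_univ
  have htop : ∀ k : ℕ, (k : WithTop ℕ∞) ≤ ∞ := fun k => by exact_mod_cast le_top
  have hρ2 : 0 < ρ ^ 2 := by positivity
  have ht₀ : t₀ ∈ 𝒯 := hI ⟨by linarith, le_rfl⟩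
  -- ### a margin above `t₀`
  obtain ⟨δ, hδ, hδ𝒯⟩ : ∃ δ > 0, Icc (t₀ - ρ ^ 2) (t₀ + δ) ⊆ 𝒯 := by
    obtain ⟨ε, hε, hball⟩ := Metric.isOpen_iff.1 h𝒯 t₀ ht₀
    refine ⟨ε / 2, by positivity, fun t ht => ?_⟩
    by_cases hle : t ≤ t₀
    · exact hI ⟨ht.1, hle⟩
    · refine hball (mem_ball.2 ?_)
      rw [Real.dist_eq, abs_of_pos (by linarith)]
      linarith [ht.2]
  -- ### the cut-offs
  set r : ℝ := ρ / 2 with hr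
  have hr0 : 0 < r := by positivity
  have h2r : 2 * r = ρ := by rw [hr]; ring
  obtain ⟨hφs, hφ0, hφ1, hφone, hφzero, -, hφcs, hφit0, hφfd0, hφbd⟩ := hφf y₀ r hr0
  set φ : E → ℝ := φf y₀ r with hφ_def
  set c₁ : ℝ := t₀ - 3 * ρ ^ 2 / 4 with hc₁
  set k₁ : ℝ := 2 / ρ ^ 2 with hk₁
  have hk₁0 : 0 < k₁ := by positivity
  have hck₁ : c₁ + 1 / k₁ = t₀ - ρ ^ 2 / 4 := by rw [hc₁, hk₁]; field_simp; ring
  set ψ₁ : ℝ → ℝ := fun τ => Real.smoothTransition (k₁ * (τ - c₁)) with hψ₁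
  obtain ⟨hψ₁s, hψ₁0, hψ₁1, hψ₁zero, hψ₁one, hψ₁d, hψ₁d0⟩ :
      ContDiff ℝ ∞ ψ₁ ∧ (∀ τ, 0 ≤ ψ₁ τ) ∧ (∀ τ, ψ₁ τ ≤ 1) ∧ (∀ τ, τ ≤ c₁ → ψ₁ τ = 0) ∧
      (∀ τ, c₁ + 1 / k₁ ≤ τ → ψ₁ τ = 1) ∧ (∀ τ, |deriv ψ₁ τ| ≤ M₁ * k₁) ∧
      (∀ τ, c₁ + 1 / k₁ < τ → deriv ψ₁ τ = 0) :=
    scaledTransition_props hM₁ hk₁0 c₁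
  set k₂ : ℝ := 3 / δ with hk₂
  have hk₂0 : 0 < k₂ := by positivity
  -- `ψ₂ τ = smoothTransition (k₂ ((t₀ + 2δ/3) - τ))`: `= 1` for `τ ≤ t₀ + δ/3`, `= 0` for
  -- `t₀ + 2δ/3 ≤ τ`
  set ψ₂ : ℝ → ℝ := fun τ => Real.smoothTransition (k₂ * (t₀ + 2 * δ / 3 - τ)) with hψ₂
  have hψ₂s : ContDiff ℝ ∞ ψ₂ :=
    Real.smoothTransition.contDiff.comp (contDiff_const.mul (contDiff_const.sub contDiff_id))
  have hψ₂one : ∀ τ, τ ≤ t₀ + δ / 3 → ψ₂ τ = 1 := fun τ hτ => by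
    refine Real.smoothTransition.one_of_one_le ?_
    have : δ / 3 ≤ t₀ + 2 * δ / 3 - τ := by linarith
    calc (1 : ℝ) = k₂ * (δ / 3) := by rw [hk₂]; field_simp
      _ ≤ k₂ * (t₀ + 2 * δ / 3 - τ) := by gcongr
  have hψ₂zero : ∀ τ, t₀ + 2 * δ / 3 ≤ τ → ψ₂ τ = 0 := fun τ hτ =>
    Real.smoothTransition.zero_of_nonpos (mul_nonpos_of_nonneg_of_nonpos hk₂0.le (by linarith))
  set Ψ : ℝ → ℝ := fun τ => ψ₁ τ * ψ₂ τ with hΨ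
  have hΨs : ContDiff ℝ ∞ Ψ := hψ₁s.mul hψ₂s
  have hΨsupp : ∀ τ, Ψ τ ≠ 0 → τ ∈ Ioo c₁ (t₀ + 2 * δ / 3) := fun τ hτ => by
    refine ⟨lt_of_not_ge fun h => hτ ?_, lt_of_not_ge fun h => hτ ?_⟩
    · simp [hΨ, hψ₁zero τ h]
    · simp [hΨ, hψ₂zero τ h]
  have hΨts : tsupport Ψ ⊆ Icc c₁ (t₀ + 2 * δ / 3) :=
    closure_minimal (fun τ hτ => Ioo_subset_Icc_self (hΨsupp τ hτ)) isClosed_Icc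
  have hIcc𝒯 : Icc c₁ (t₀ + 2 * δ / 3) ⊆ 𝒯 := fun τ hτ =>
    hδ𝒯 ⟨by rw [hc₁] at hτ; linarith [hτ.1], by linarith [hτ.2]⟩
  have hΨ𝒯 : tsupport Ψ ⊆ 𝒯 := hΨts.trans hIcc𝒯
  -- near any `τ < t₀ + δ/3`, `Ψ = ψ₁`
  have hΨev : ∀ τ, τ < t₀ + δ / 3 → Ψ =ᶠ[𝓝 τ] ψ₁ := fun τ hτ => by
    filter_upwards [(isOpen_gt' (t₀ + δ / 3)).mem_nhds hτ] with σ hσ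
    simp [hΨ, hψ₂one σ hσ.le]
  -- ### the localized function `U = Ψ φ w`
  set U : ℝ × E → ℝ := fun p => Ψ p.1 * (φ p.2 * W p) with hU_def
  have hUs : ContDiff ℝ ∞ U := by
    refine contDiff_iff_contDiffAt.2 fun p => ?_
    by_cases hp : p.1 ∈ 𝒯
    · have hWp : ContDiffAt ℝ ∞ W p := hw.contDiffAt (hO.mem_nhds ⟨hp, mem_univ _⟩)
      exact (hΨs.comp contDiff_fst).contDiffAt.mul ((hφs.comp contDiff_snd).contDiffAt.mul hWp)
    · have hp' : p.1 ∉ tsupport Ψ := fun h => hp (hΨ𝒯 h)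
      have hev : ∀ᶠ q in 𝓝 p, Ψ q.1 = 0 :=
        (continuousAt_fst (p := p)).eventually (notMem_tsupport_iff_eventuallyEq.1 hp')
      refine (contDiffAt_const (c := (0 : ℝ))).congr_of_eventuallyEq ?_
      filter_upwards [hev] with q hq
      simp [hU_def, hq]
  have hUcs : HasCompactSupport U := by
    refine HasCompactSupport.intro ((isCompact_Icc (a := c₁) (b := t₀ + 2 * δ / 3)).prod
      (isCompact_closedBall y₀ ρ)) fun p hp => ?_
    rw [mem_prod, not_and_or] at hp
    rcases hp with hp | hp
    · have : Ψ p.1 = 0 := image_eq_zero_of_notMem_tsupport fun h => hp (hΨts h)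
      simp [hU_def, this]
    · have : φ p.2 = 0 := hφzero _ (by rw [h2r]; exact le_of_lt (not_le.1 (mt mem_closedBall.2 hp)))
      simp [hU_def, this]
  -- initial time `s = t₀ − 7ρ²/8`: `U(s, ·) = 0`
  set s : ℝ := t₀ - 7 * ρ ^ 2 / 8 with hs_def
  have hst : s < t₀ := by rw [hs_def]; linarith
  have hsc : s ≤ c₁ := by rw [hs_def, hc₁]; linarith
  have hUs0 : ∀ z, U (s, z) = 0 := fun z => by simp [hU_def, hΨ, hψ₁zero s hsc]
  -- top value
  have hUtop : U (t₀, y₀) = w t₀ y₀ := by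
    have h1 : ψ₁ t₀ = 1 := hψ₁one t₀ (by rw [hck₁]; linarith)
    have h2 : ψ₂ t₀ = 1 := hψ₂one t₀ (by linarith)
    have h3 : φ y₀ = 1 := hφone y₀ (by simp [hr0.le])
    simp [hU_def, hΨ, h1, h2, h3, hW]
  -- ### Duhamel
  have hD := eq_intervalIntegral_heatExtension_of_contDiff hUs hUcs hst hUs0 y₀
  rw [hUtop] at hD
  set q : ℝ → E → ℝ := fun τ z => fderiv ℝ U (τ, z) (1, 0) - (Δ fun z' => U (τ, z')) z with hq_def
  set G : ℝ → ℝ := fun τ => ∫ y in closedBall y₀ ρ, w τ y with hG_def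
  set H : ℝ → ℝ := fun τ => heatExtension (q τ) (t₀ - τ) y₀ with hH_def
  have hD' : w t₀ y₀ = ∫ τ in s..t₀, H τ := hD
  -- ### smoothness data for `φ`
  have hφ2 : ContDiff ℝ 2 φ := hφs.of_le (htop 2)
  have hφfd_le : ∀ z, ‖fderiv ℝ φ z‖ ≤ Cφ 1 / r := fun z => by
    have h := hφbd 1 z
    rwa [pow_one, ← norm_iteratedFDeriv_fderiv (n := 0), norm_iteratedFDeriv_zero] at h
  have hb1 : ∀ i, ‖b i‖ = 1 := fun i => b.orthonormal.1 i
  have hddφ_eq : ∀ i z, fderiv ℝ (fun y => fderiv ℝ φ y (b i)) z (b i) =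
      iteratedFDeriv ℝ 2 φ z ![b i, b i] := fun i z =>
    fderiv_fderiv_apply_eq_iteratedFDeriv_two' hφ2 z (b i)
  have hddφ_le : ∀ i z, |fderiv ℝ (fun y => fderiv ℝ φ y (b i)) z (b i)| ≤ Cφ 2 / r ^ 2 :=
    fun i z => by
    rw [hddφ_eq, ← Real.norm_eq_abs]
    refine (ContinuousMultilinearMap.le_opNorm _ _).trans ?_
    have hprod : ∏ j, ‖(![b i, b i] : Fin 2 → E) j‖ = 1 := by simp [Fin.prod_univ_two, hb1]
    rw [hprod, mul_one]
    exact hφbd 2 z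
  -- ### the bound at a fixed time `τ ∈ (s, t₀)`
  have hbound : ∀ τ ∈ Ioo s t₀, H τ ≤ C' / ρ ^ (n + 2) * G τ := by
    intro τ hτ
    have hτI : τ ∈ Icc (t₀ - ρ ^ 2) t₀ := ⟨by rw [hs_def] at hτ; linarith [hτ.1], hτ.2.le⟩
    have hτ𝒯 : τ ∈ 𝒯 := hI hτI
    have hτ3 : τ < t₀ + δ / 3 := by linarith [hτ.2]
    have hσ : 0 < t₀ - τ := sub_pos.2 hτ.2
    -- the slice and its time derivative
    set f : E → ℝ := w τ with hf_def
    have hfs : ContDiff ℝ ∞ f :=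
      hw.comp_contDiff (contDiff_prodMk_right τ) fun z => ⟨hτ𝒯, mem_univ _⟩
    have hf2 : ContDiff ℝ 2 f := hfs.of_le (htop 2)
    set g : E → ℝ := fun z => fderiv ℝ W (τ, z) ((1 : ℝ), (0 : E)) with hg_def
    have hWd : ∀ z, DifferentiableAt ℝ W (τ, z) := fun z =>
      (hw.differentiableOn (by simp)).differentiableAt (hO.mem_nhds ⟨hτ𝒯, mem_univ _⟩)
    have hg_deriv : ∀ z, HasDerivAt (fun s' => w s' z) (g z) τ := fun z => by
      have h := (hWd z).hasFDerivAt.comp_hasDerivAt τ (hasDerivAt_prodMk_time τ z)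
      simpa [hW, Function.comp_def] using h
    have hgc : Continuous g := by
      have h := (hw.continuousOn_fderiv_of_isOpen hO (by simp)).comp_continuous
        (Continuous.prodMk_right τ) fun z => ⟨hτ𝒯, mem_univ _⟩
      exact h.clm_apply continuous_const
    -- the subsolution property in frame form
    have hsubτ : ∀ z, φ z ≠ 0 → g z ≤ ∑ i, fderiv ℝ (fun y => fderiv ℝ f y (b i)) z (b i) := by
      intro z hz
      have hzB : z ∈ closedBall y₀ ρ := by
        rw [mem_closedBall]
        by_contra h
        exact hz (hφzero z (by rw [h2r]; exact (not_le.1 h).le))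
      have h1 := hsub τ hτI z hzB
      rwa [(hg_deriv z).deriv, laplacian_apply_eq_sum_fderiv_fderiv b hf2] at h1
    -- ### the source `q τ = ψ₁' φ f + ψ₁ φ g − ψ₁ ∑ ∂ᵢ∂ᵢ(φ f)`
    have hΨτ : Ψ τ = ψ₁ τ := (hΨev τ hτ3).eq_of_nhds
    have hΨ'τ : deriv Ψ τ = deriv ψ₁ τ := (hΨev τ hτ3).deriv_eq
    have hU2 : ContDiff ℝ 2 (fun z' => U (τ, z')) :=
      (hUs.comp (contDiff_prodMk_right τ)).of_le (htop 2)
    have hφf2 : ContDiff ℝ 2 (fun x => φ x * f x) := (hφs.mul hfs).of_le (htop 2)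
    have hq : ∀ z, q τ z = deriv ψ₁ τ * (φ z * f z) + ψ₁ τ * (φ z * g z) -
        ψ₁ τ * ∑ i, fderiv ℝ (fun y => fderiv ℝ (fun x => φ x * f x) y (b i)) z (b i) := by
      intro z
      -- time part, by uniqueness of derivatives
      have h1 : HasDerivAt (fun σ' => U (σ', z)) (fderiv ℝ U (τ, z) (1, 0)) τ := by
        have h := ((hUs.differentiable (by simp)) (τ, z)).hasFDerivAt.comp_hasDerivAt τ
          (hasDerivAt_prodMk_time τ z)
        simpa [Function.comp_def] using h
      have hΨd : HasDerivAt Ψ (deriv Ψ τ) τ := ((hΨs.differentiable (by simp)) τ).hasDerivAt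
      have h2 : HasDerivAt (fun σ' => U (σ', z))
          (deriv Ψ τ * (φ z * f z) + Ψ τ * (φ z * g z)) τ := by
        have := hΨd.mul ((hg_deriv z).const_mul (φ z))
        simpa [hU_def, hW, hf_def, Pi.mul_def] using this
      have h12 : fderiv ℝ U (τ, z) (1, 0) = deriv ψ₁ τ * (φ z * f z) + ψ₁ τ * (φ z * g z) := by
        rw [h1.unique h2, hΨτ, hΨ'τ]
      -- space part
      have hUslice : (fun z' => U (τ, z')) = fun z' => ψ₁ τ * (φ z' * f z') := by
        funext z'; simp [hU_def, hΨτ, hW, hf_def]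
      have h3 : (Δ fun z' => U (τ, z')) z =
          ψ₁ τ * ∑ i, fderiv ℝ (fun y => fderiv ℝ (fun x => φ x * f x) y (b i)) z (b i) := by
        rw [laplacian_apply_eq_sum_fderiv_fderiv b hU2, hUslice, Finset.mul_sum]
        exact Finset.sum_congr rfl fun i _ => fderiv_fderiv_const_mul_apply hφf2 _ z (b i)
      simp only [hq_def]
      rw [h12, h3]
    -- ### the heat-kernel average as an integral against `G(y₀ − z)`
    have hHE : H τ = ∫ z, heatKernel (t₀ - τ) (y₀ - z) * q τ z := by
      simp only [hH_def, heatExtension_apply, smul_eq_mul]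
      have h := integral_sub_left_eq_self (fun z => heatKernel (t₀ - τ) (y₀ - z) * q τ z)
        volume y₀
      simp only [sub_sub_cancel] at h
      exact h
    -- ### the fixed-time estimate
    have hFT := integral_heatKernel_mul_source_le b hφs hφcs hφ0 hf2 hgc hsubτ hσ y₀ (hψ₁0 τ)
      (deriv ψ₁ τ)
    set Kz : E → ℝ := fun z => heatKernel (t₀ - τ) (y₀ - z) with hKz
    set m : E → ℝ := fun z => deriv ψ₁ τ * (Kz z * φ z) +
      ψ₁ τ * (Kz z * ∑ i, fderiv ℝ (fun y => fderiv ℝ φ y (b i)) z (b i)) +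
      2 * ψ₁ τ * ∑ i, fderiv ℝ Kz z (b i) * fderiv ℝ φ z (b i) with hm
    have hKq : (∫ z, Kz z * q τ z) ≤ ∫ z, f z * m z := by
      have : (∫ z, Kz z * q τ z) = ∫ z, Kz z * (deriv ψ₁ τ * (φ z * f z) + ψ₁ τ * (φ z * g z) -
          ψ₁ τ * ∑ i, fderiv ℝ (fun y => fderiv ℝ (fun x => φ x * f x) y (b i)) z (b i)) :=
        integral_congr_ae (Eventually.of_forall fun z => by simp only [hq])
      rw [this]
      exact hFT
    -- ### the weight `m` vanishes off `B̄_ρ(y₀)` and is `O(ρ^{-n-2})` on it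
    have hm0 : ∀ z, z ∉ closedBall y₀ ρ → m z = 0 := by
      intro z hz
      have hd : 2 * r < dist z y₀ := by rw [h2r]; exact not_le.1 (mt mem_closedBall.2 hz)
      have e1 : φ z = 0 := hφzero z hd.le
      have e2 : fderiv ℝ φ z = 0 := hφfd0 z (Or.inr hd)
      have e3 : ∀ i, fderiv ℝ (fun y => fderiv ℝ φ y (b i)) z (b i) = 0 := fun i => by
        rw [hddφ_eq, hφit0 2 (by norm_num) z (Or.inr hd)]; rfl
      simp [hm, e1, e2, e3]
    have hKz0 : ∀ z, 0 ≤ Kz z := fun z => (heatKernel_pos hσ _).le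
    have hT1 : ∀ z, |deriv ψ₁ τ * (Kz z * φ z)| ≤ 2 * M₁ * Cπ / ρ ^ (n + 2) := by
      intro z
      by_cases hστ : ρ ^ 2 / 4 ≤ t₀ - τ
      · have hK : Kz z ≤ Cπ / ρ ^ n := heatKernel_le_of_sq_le hρ hστ _
        rw [abs_mul, abs_of_nonneg (mul_nonneg (hKz0 z) (hφ0 z))]
        calc |deriv ψ₁ τ| * (Kz z * φ z) ≤ (M₁ * k₁) * (Cπ / ρ ^ n * 1) :=
              mul_le_mul (hψ₁d τ) (mul_le_mul hK (hφ1 z) (hφ0 z) (by positivity))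
                (mul_nonneg (hKz0 z) (hφ0 z)) (by positivity)
          _ = 2 * M₁ * Cπ / ρ ^ (n + 2) := by rw [hk₁, pow_add]; field_simp
      · have hτ' : c₁ + 1 / k₁ < τ := by rw [hck₁]; linarith [not_le.1 hστ]
        rw [hψ₁d0 τ hτ', zero_mul, abs_zero]
        positivity
    have hT2 : ∀ z, |ψ₁ τ * (Kz z * ∑ i, fderiv ℝ (fun y => fderiv ℝ φ y (b i)) z (b i))| ≤
        4 * n * Cφ 2 * CK / ρ ^ (n + 2) := by
      intro z
      by_cases hzr : r ≤ dist z y₀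
      · have hK : Kz z ≤ CK / ρ ^ n :=
          hCK hσ hρ (y₀ - z) (by rw [← dist_eq_norm, dist_comm]; rwa [hr] at hzr)
        have hS : |∑ i, fderiv ℝ (fun y => fderiv ℝ φ y (b i)) z (b i)| ≤ n * (Cφ 2 / r ^ 2) :=
          (Finset.abs_sum_le_sum_abs _ _).trans ((Finset.sum_le_sum fun i _ => hddφ_le i z).trans
            (by simp [hn]))
        rw [abs_mul, abs_mul, abs_of_nonneg (hψ₁0 τ), abs_of_nonneg (hKz0 z)]
        calc ψ₁ τ * (Kz z * |∑ i, fderiv ℝ (fun y => fderiv ℝ φ y (b i)) z (b i)|)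
            ≤ 1 * (CK / ρ ^ n * (n * (Cφ 2 / r ^ 2))) :=
              mul_le_mul (hψ₁1 τ) (mul_le_mul hK hS (abs_nonneg _) (by positivity))
                (mul_nonneg (hKz0 z) (abs_nonneg _)) zero_le_one
          _ = 4 * n * Cφ 2 * CK / ρ ^ (n + 2) := by rw [hr, pow_add]; field_simp; ring
      · have e3 : ∀ i, fderiv ℝ (fun y => fderiv ℝ φ y (b i)) z (b i) = 0 := fun i => by
          rw [hddφ_eq, hφit0 2 (by norm_num) z (Or.inl (not_le.1 hzr))]; rfl
        simp only [e3, Finset.sum_const_zero, mul_zero, abs_zero]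
        have := hCφ0 2
        positivity
    have hT3 : ∀ z, |2 * ψ₁ τ * ∑ i, fderiv ℝ Kz z (b i) * fderiv ℝ φ z (b i)| ≤
        4 * n * Cφ 1 * CG / ρ ^ (n + 2) := by
      intro z
      by_cases hzr : r ≤ dist z y₀
      · have hyz : ρ / 2 ≤ ‖y₀ - z‖ := by rw [← dist_eq_norm, dist_comm]; rwa [hr] at hzr
        have hdK : ∀ i, |fderiv ℝ Kz z (b i)| ≤ CG / ρ ^ (n + 1) := fun i =>
          (abs_fderiv_heatKernel_sub_apply_le hσ y₀ z (b i)).trans (by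
            rw [hb1, mul_one]; exact hCG hσ hρ _ hyz)
        have hdφ : ∀ i, |fderiv ℝ φ z (b i)| ≤ Cφ 1 / r := fun i => by
          rw [← Real.norm_eq_abs]
          exact ((fderiv ℝ φ z).le_opNorm _).trans (by rw [hb1, mul_one]; exact hφfd_le z)
        have hS : |∑ i, fderiv ℝ Kz z (b i) * fderiv ℝ φ z (b i)| ≤
            n * (CG / ρ ^ (n + 1) * (Cφ 1 / r)) :=
          calc |∑ i, fderiv ℝ Kz z (b i) * fderiv ℝ φ z (b i)|
              ≤ ∑ i, |fderiv ℝ Kz z (b i) * fderiv ℝ φ z (b i)| := Finset.abs_sum_le_sum_abs _ _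
            _ ≤ ∑ _i : Fin n, CG / ρ ^ (n + 1) * (Cφ 1 / r) := Finset.sum_le_sum fun i _ => by
                rw [abs_mul]
                exact mul_le_mul (hdK i) (hdφ i) (abs_nonneg _)
                  (div_nonneg hCG0 (pow_nonneg hρ.le _))
            _ = n * (CG / ρ ^ (n + 1) * (Cφ 1 / r)) := by simp
        rw [abs_mul, abs_mul, abs_of_nonneg (hψ₁0 τ), abs_two]
        calc 2 * ψ₁ τ * |∑ i, fderiv ℝ Kz z (b i) * fderiv ℝ φ z (b i)|
            ≤ 2 * 1 * (n * (CG / ρ ^ (n + 1) * (Cφ 1 / r))) := by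
              gcongr
              · exact hψ₁1 τ
          _ = 4 * n * Cφ 1 * CG / ρ ^ (n + 2) := by rw [hr, pow_add, pow_add]; field_simp; ring
      · have e2 : fderiv ℝ φ z = 0 := hφfd0 z (Or.inl (not_le.1 hzr))
        simp only [e2, _root_.zero_apply, mul_zero, Finset.sum_const_zero, abs_zero]
        have := hCφ0 1
        positivity
    have hmle : ∀ z, m z ≤ C' / ρ ^ (n + 2) := fun z => by
      have h := (le_abs_self (m z)).trans ((abs_add_le _ _).trans
        (add_le_add ((abs_add_le _ _).trans (add_le_add (hT1 z) (hT2 z))) (hT3 z)))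
      refine h.trans (le_of_eq ?_)
      rw [hC']
      ring
    -- ### `∫ f m ≤ C' ρ^{-n-2} ∫_{B̄_ρ} f`
    have hKzs : ContDiff ℝ ∞ Kz :=
      (contDiff_heatKernel' (t₀ - τ)).comp (contDiff_const.sub contDiff_id)
    have hmc : Continuous m := by
      have hdd : ∀ i, Continuous fun z => fderiv ℝ (fun y => fderiv ℝ φ y (b i)) z (b i) :=
        fun i => by
        have h1 : ContDiff ℝ 1 fun y => fderiv ℝ φ y (b i) :=
          (hφ2.fderiv_right (m := 1) le_rfl).clm_apply contDiff_const
        exact (h1.continuous_fderiv one_ne_zero).clm_apply continuous_const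
      have hdK : ∀ i, Continuous fun z => fderiv ℝ Kz z (b i) := fun i =>
        (hKzs.continuous_fderiv (by simp)).clm_apply continuous_const
      have hdφc : ∀ i, Continuous fun z => fderiv ℝ φ z (b i) := fun i =>
        (hφs.continuous_fderiv (by simp)).clm_apply continuous_const
      simp only [hm]
      exact ((continuous_const.mul (hKzs.continuous.mul hφs.continuous)).add
        (continuous_const.mul (hKzs.continuous.mul (continuous_finsetSum _ fun i _ => hdd i)))).add
        (continuous_const.mul (continuous_finsetSum _ fun i _ => (hdK i).mul (hdφc i)))
    have hfm : (∫ z, f z * m z) ≤ C' / ρ ^ (n + 2) * G τ := by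
      have hset : (∫ z, f z * m z) = ∫ z in closedBall y₀ ρ, f z * m z :=
        (setIntegral_eq_integral_of_forall_compl_eq_zero fun z hz => by
          rw [hm0 z hz, mul_zero]).symm
      rw [hset]
      have hf0 : ∀ z ∈ closedBall y₀ ρ, 0 ≤ f z := fun z hz => hw0 τ hτI z hz
      calc ∫ z in closedBall y₀ ρ, f z * m z
          ≤ ∫ z in closedBall y₀ ρ, f z * (C' / ρ ^ (n + 2)) := by
            refine setIntegral_mono_on ((hfs.continuous.mul hmc).continuousOn.integrableOn_compact
              (isCompact_closedBall y₀ ρ)) ((hfs.continuous.mul continuous_const).continuousOn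
              |>.integrableOn_compact (isCompact_closedBall y₀ ρ)) measurableSet_closedBall
              fun z hz => ?_
            exact mul_le_mul_of_nonneg_left (hmle z) (hf0 z hz)
        _ = C' / ρ ^ (n + 2) * G τ := by
            rw [MeasureTheory.integral_mul_const, mul_comm]
    calc H τ = ∫ z, Kz z * q τ z := hHE
      _ ≤ ∫ z, f z * m z := hKq
      _ ≤ C' / ρ ^ (n + 2) * G τ := hfm
  -- ### integration in time
  have hle : t₀ - ρ ^ 2 ≤ t₀ := by linarith
  have hG0 : ∀ τ ∈ Icc (t₀ - ρ ^ 2) t₀, 0 ≤ G τ := fun τ hτ =>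
    setIntegral_nonneg measurableSet_closedBall fun y hy => hw0 τ hτ y hy
  have hGc : ContinuousOn G (Icc (t₀ - ρ ^ 2) t₀) := by
    set pr : ℝ → ℝ := fun τ => (projIcc (t₀ - ρ ^ 2) t₀ hle τ : ℝ) with hpr
    have hprc : Continuous pr := continuous_subtype_val.comp continuous_projIcc
    have hpr𝒯 : ∀ τ, pr τ ∈ 𝒯 := fun τ => hI (projIcc _ _ hle τ).2
    have hcont : Continuous (fun p : ℝ × E => w (pr p.1) p.2) :=
      hw.continuousOn.comp_continuous ((hprc.comp continuous_fst).prodMk continuous_snd)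
        fun p => ⟨hpr𝒯 p.1, mem_univ _⟩
    have hGt : Continuous fun τ => ∫ y in closedBall y₀ ρ, w (pr τ) y :=
      continuous_parametric_integral_of_continuous (f := fun τ y => w (pr τ) y) hcont
        (isCompact_closedBall y₀ ρ)
    refine hGt.continuousOn.congr fun τ hτ => ?_
    simp [hG_def, hpr, projIcc_of_mem hle hτ]
  have hGi : IntervalIntegrable G volume (t₀ - ρ ^ 2) t₀ :=
    (ContinuousOn.intervalIntegrable (by rwa [uIcc_of_le hle]))
  have hGi' : IntervalIntegrable G volume s t₀ :=
    ContinuousOn.intervalIntegrable (by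
      rw [uIcc_of_le hst.le]
      exact hGc.mono (Icc_subset_Icc (by rw [hs_def]; linarith) le_rfl))
  have hRHS0 : 0 ≤ ∫ τ in (t₀ - ρ ^ 2)..t₀, G τ :=
    intervalIntegral.integral_nonneg hle fun τ hτ => hG0 τ hτ
  have hρn : 0 < ρ ^ (n + 2) := pow_pos hρ _
  by_cases hHi : IntervalIntegrable H volume s t₀
  · calc w t₀ y₀ = ∫ τ in s..t₀, H τ := hD'
      _ ≤ ∫ τ in s..t₀, C' / ρ ^ (n + 2) * G τ := by
          exact intervalIntegral.integral_mono_on_of_le_Ioo hst.le hHi (hGi'.const_mul _)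
            fun τ hτ => hbound τ hτ
      _ = C' / ρ ^ (n + 2) * ∫ τ in s..t₀, G τ := intervalIntegral.integral_const_mul _ _
      _ ≤ C' / ρ ^ (n + 2) * ∫ τ in (t₀ - ρ ^ 2)..t₀, G τ := by
          refine mul_le_mul_of_nonneg_left (intervalIntegral.integral_mono_interval
            (by rw [hs_def]; linarith) hst.le le_rfl ?_ hGi) (by positivity)
          exact (ae_restrict_iff' measurableSet_Ioc).2
            (ae_of_all _ fun τ hτ => hG0 τ ⟨hτ.1.le, hτ.2⟩)
      _ ≤ (C' + 1) / ρ ^ (n + 2) * ∫ τ in (t₀ - ρ ^ 2)..t₀, G τ := by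
          refine mul_le_mul_of_nonneg_right ?_ hRHS0
          exact (div_le_div_iff_of_pos_right hρn).2 (by linarith)
  · rw [intervalIntegral.integral_undef hHi] at hD'
    rw [hD']
    exact mul_nonneg (div_nonneg (by linarith) hρn.le) hRHS0

/-- **The parabolic mean-value inequality, frame form.** The same statement with the
subsolution hypothesis written as `∂ₜw ≤ ∑ᵢ ∂ᵢ∂ᵢ w` in an orthonormal basis `b` of `E`.
[cite: Lieberman1996, Thm. 6.17 (m = 1) and Thm. 7.36 (p = 1, f = 0)] -/
theorem le_mul_integral_of_heat_subsolution_basis {ι : Type*} [Fintype ι]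
    (b : OrthonormalBasis ι ℝ E) :
    ∃ C : ℝ, 0 < C ∧ ∀ {w : ℝ → E → ℝ} {𝒯 : Set ℝ}, IsOpen 𝒯 →
      ContDiffOn ℝ ∞ (fun p : ℝ × E => w p.1 p.2) (𝒯 ×ˢ (univ : Set E)) →
      ∀ {t₀ : ℝ} {y₀ : E} {ρ : ℝ}, 0 < ρ → Icc (t₀ - ρ ^ 2) t₀ ⊆ 𝒯 →
      (∀ t ∈ Icc (t₀ - ρ ^ 2) t₀, ∀ y ∈ closedBall y₀ ρ, 0 ≤ w t y) →
      (∀ t ∈ Icc (t₀ - ρ ^ 2) t₀, ∀ y ∈ closedBall y₀ ρ,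
          deriv (fun s => w s y) t ≤ ∑ i, fderiv ℝ (fun z => fderiv ℝ (w t) z (b i)) y (b i)) →
      w t₀ y₀ ≤ C / ρ ^ (Module.finrank ℝ E + 2) *
        ∫ t in (t₀ - ρ ^ 2)..t₀, ∫ y in closedBall y₀ ρ, w t y := by
  obtain ⟨C, hC, h⟩ := le_mul_integral_of_heat_subsolution (E := E)
  refine ⟨C, hC, fun {w 𝒯} h𝒯 hw {t₀ y₀ ρ} hρ hI hw0 hsub => h h𝒯 hw hρ hI hw0 fun t ht y hy => ?_⟩
  have htop : ∀ k : ℕ, (k : WithTop ℕ∞) ≤ ∞ := fun k => by exact_mod_cast le_top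
  have h2 : ContDiff ℝ 2 (w t) :=
    (hw.comp_contDiff (contDiff_prodMk_right t) fun z => ⟨hI ht, mem_univ _⟩).of_le (htop 2)
  rw [laplacian_apply_eq_sum_fderiv_fderiv b h2]
  exact hsub t ht y hy

/-- **Mean-value inequality for linear subsolutions, frame form.** If `q ≥ 0` is jointly
smooth on `𝒯 × E` and satisfies `∂ₜq − ∑ᵢ∂ᵢ∂ᵢq ≤ Λ q` on the cylinder `[t₀ − ρ², t₀] × B̄_ρ(y₀)`
(`[t₀ − ρ², t₀] ⊆ 𝒯`) with `0 ≤ Λ` and `Λ ρ² ≤ 1`, then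
`q(t₀, y₀) ≤ e·C ρ^{-(n+2)} ∫_{t₀-ρ²}^{t₀} ∫_{B̄_ρ(y₀)} q` with the constant `C` of
`le_mul_integral_of_heat_subsolution` (apply it to the subsolution `e^{Λ(t₀−t)} q ≤ e·q`).
[cite: Lieberman1996, Thm. 6.17 (m = 1) and Thm. 7.36 (p = 1, f = 0)] -/
theorem le_mul_integral_of_linear_subsolution_basis {ι : Type*} [Fintype ι]
    (b : OrthonormalBasis ι ℝ E) :
    ∃ C : ℝ, 0 < C ∧ ∀ {q : ℝ → E → ℝ} {𝒯 : Set ℝ}, IsOpen 𝒯 →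
      ContDiffOn ℝ ∞ (fun p : ℝ × E => q p.1 p.2) (𝒯 ×ˢ (univ : Set E)) →
      ∀ {t₀ : ℝ} {y₀ : E} {ρ Λ : ℝ}, 0 < ρ → Icc (t₀ - ρ ^ 2) t₀ ⊆ 𝒯 → 0 ≤ Λ → Λ * ρ ^ 2 ≤ 1 →
      (∀ t ∈ Icc (t₀ - ρ ^ 2) t₀, ∀ y ∈ closedBall y₀ ρ, 0 ≤ q t y) →
      (∀ t ∈ Icc (t₀ - ρ ^ 2) t₀, ∀ y ∈ closedBall y₀ ρ,
          deriv (fun s => q s y) t -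
            ∑ i, fderiv ℝ (fun z => fderiv ℝ (q t) z (b i)) y (b i) ≤ Λ * q t y) →
      q t₀ y₀ ≤ C / ρ ^ (Module.finrank ℝ E + 2) *
        ∫ t in (t₀ - ρ ^ 2)..t₀, ∫ y in closedBall y₀ ρ, q t y := by
  obtain ⟨C, hC, hMV⟩ := le_mul_integral_of_heat_subsolution_basis (E := E) b
  refine ⟨Real.exp 1 * C, by positivity, ?_⟩
  intro q 𝒯 h𝒯 hq t₀ y₀ ρ Λ hρ hI hΛ0 hΛρ hq0 hsub
  have htop : ∀ k : ℕ, (k : WithTop ℕ∞) ≤ ∞ := fun k => by exact_mod_cast le_top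
  have hO : IsOpen (𝒯 ×ˢ (univ : Set E)) := h𝒯.prod isOpen_univ
  set w : ℝ → E → ℝ := fun s y => Real.exp (Λ * (t₀ - s)) * q s y with hw_def
  have hexp_s : ContDiff ℝ ∞ fun p : ℝ × E => Real.exp (Λ * (t₀ - p.1)) :=
    (contDiff_const.mul (contDiff_const.sub contDiff_fst)).exp
  have hw_joint : ContDiffOn ℝ ∞ (fun p : ℝ × E => w p.1 p.2) (𝒯 ×ˢ (univ : Set E)) :=
    hexp_s.contDiffOn.mul hq
  have hw0 : ∀ s ∈ Icc (t₀ - ρ ^ 2) t₀, ∀ y ∈ closedBall y₀ ρ, 0 ≤ w s y := fun s hs y hy =>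
    mul_nonneg (Real.exp_pos _).le (hq0 s hs y hy)
  -- ### the subsolution property of `w`
  have hwsub : ∀ s ∈ Icc (t₀ - ρ ^ 2) t₀, ∀ y ∈ closedBall y₀ ρ,
      deriv (fun s' => w s' y) s ≤ ∑ i, fderiv ℝ (fun z => fderiv ℝ (w s) z (b i)) y (b i) := by
    intro s hs y hy
    have hs𝒯 : s ∈ 𝒯 := hI hs
    have hB := hsub s hs y hy
    -- time derivative of the slice of `q`
    have hqd : DifferentiableAt ℝ (fun p : ℝ × E => q p.1 p.2) (s, y) :=
      (hq.differentiableOn (by simp)).differentiableAt (hO.mem_nhds ⟨hs𝒯, mem_univ _⟩)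
    have hqs : HasDerivAt (fun s' => q s' y) (deriv (fun s' => q s' y) s) s := by
      have h := hqd.hasFDerivAt.comp_hasDerivAt s (hasDerivAt_prodMk_time s y)
      have h' : HasDerivAt (fun s' => q s' y)
          (fderiv ℝ (fun p : ℝ × E => q p.1 p.2) (s, y) (1, 0)) s := by
        simpa [Function.comp_def] using h
      rwa [h'.deriv]
    have hexpd : HasDerivAt (fun s' => Real.exp (Λ * (t₀ - s')))
        (Real.exp (Λ * (t₀ - s)) * (-Λ)) s := by
      have h : HasDerivAt (fun s' => Λ * (t₀ - s')) (Λ * (0 - 1)) s :=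
        ((hasDerivAt_const s t₀).sub (hasDerivAt_id s)).const_mul Λ
      convert h.exp using 1
      ring
    have hwd : HasDerivAt (fun s' => w s' y)
        (Real.exp (Λ * (t₀ - s)) * (-Λ) * q s y +
          Real.exp (Λ * (t₀ - s)) * deriv (fun s' => q s' y) s) s := hexpd.mul hqs
    rw [hwd.deriv]
    have hq2 : ContDiff ℝ 2 (q s) :=
      (hq.comp_contDiff (contDiff_prodMk_right s) fun z => ⟨hs𝒯, mem_univ _⟩).of_le (htop 2)
    have hlap : ∑ i, fderiv ℝ (fun z => fderiv ℝ (w s) z (b i)) y (b i) =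
        Real.exp (Λ * (t₀ - s)) * ∑ i, fderiv ℝ (fun z => fderiv ℝ (q s) z (b i)) y (b i) := by
      rw [Finset.mul_sum]
      exact Finset.sum_congr rfl fun i _ => fderiv_fderiv_const_mul_apply hq2 _ y (b i)
    rw [hlap]
    have hpos : 0 < Real.exp (Λ * (t₀ - s)) := Real.exp_pos _
    nlinarith [hB, mul_le_mul_of_nonneg_left hB hpos.le]
  -- ### the mean-value inequality for `w`, and `w ≤ e·q` on the cylinder
  have hmv := hMV h𝒯 hw_joint hρ hI hw0 hwsub
  have hwt : w t₀ y₀ = q t₀ y₀ := by simp [hw_def]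
  rw [hwt] at hmv
  have hK : IsCompact (closedBall y₀ ρ) := isCompact_closedBall y₀ ρ
  have hle : t₀ - ρ ^ 2 ≤ t₀ := by nlinarith
  -- continuity of the space integrals in time (a continuous extension across `[t₀ − ρ², t₀]`)
  have hcontI : ∀ {g : ℝ → E → ℝ}, ContDiffOn ℝ ∞ (fun p : ℝ × E => g p.1 p.2) (𝒯 ×ˢ univ) →
      IntervalIntegrable (fun s => ∫ y in closedBall y₀ ρ, g s y) volume (t₀ - ρ ^ 2) t₀ := by
    intro g hg
    set pr : ℝ → ℝ := fun τ => (projIcc (t₀ - ρ ^ 2) t₀ hle τ : ℝ) with hpr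
    have hprc : Continuous pr := continuous_subtype_val.comp continuous_projIcc
    have hpr𝒯 : ∀ τ, pr τ ∈ 𝒯 := fun τ => hI (projIcc _ _ hle τ).2
    have hcont : Continuous (fun p : ℝ × E => g (pr p.1) p.2) :=
      hg.continuousOn.comp_continuous ((hprc.comp continuous_fst).prodMk continuous_snd)
        fun p => ⟨hpr𝒯 p.1, mem_univ _⟩
    have hGt : Continuous fun τ => ∫ y in closedBall y₀ ρ, g (pr τ) y :=
      continuous_parametric_integral_of_continuous (f := fun τ y => g (pr τ) y) hcont hK
    have hGc : ContinuousOn (fun τ => ∫ y in closedBall y₀ ρ, g τ y) (Icc (t₀ - ρ ^ 2) t₀) := by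
      refine hGt.continuousOn.congr fun τ hτ => ?_
      simp [hpr, projIcc_of_mem hle hτ]
    exact ContinuousOn.intervalIntegrable (by rwa [uIcc_of_le hle])
  have hint_w := hcontI hw_joint
  have hint_q := (hcontI hq).const_mul (Real.exp 1)
  have hinner0 : ∀ s ∈ Icc (t₀ - ρ ^ 2) t₀, 0 ≤ ∫ y in closedBall y₀ ρ, q s y := fun s hs =>
    setIntegral_nonneg measurableSet_closedBall fun y hy => hq0 s hs y hy
  have hcomp : (∫ s in (t₀ - ρ ^ 2)..t₀, ∫ y in closedBall y₀ ρ, w s y) ≤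
      ∫ s in (t₀ - ρ ^ 2)..t₀, Real.exp 1 * ∫ y in closedBall y₀ ρ, q s y := by
    refine intervalIntegral.integral_mono_on hle hint_w hint_q fun s hs => ?_
    have hfac : (∫ y in closedBall y₀ ρ, w s y) =
        Real.exp (Λ * (t₀ - s)) * ∫ y in closedBall y₀ ρ, q s y := by
      simp only [hw_def]
      exact MeasureTheory.integral_const_mul _ _
    rw [hfac]
    refine mul_le_mul_of_nonneg_right (Real.exp_le_exp.2 ?_) (hinner0 s hs)
    calc Λ * (t₀ - s) ≤ Λ * ρ ^ 2 := by gcongr; linarith [hs.1]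
      _ ≤ 1 := hΛρ
  rw [intervalIntegral.integral_const_mul] at hcomp
  have hρn : 0 < ρ ^ (Module.finrank ℝ E + 2) := pow_pos hρ _
  calc q t₀ y₀ ≤ C / ρ ^ (Module.finrank ℝ E + 2) *
        ∫ s in (t₀ - ρ ^ 2)..t₀, ∫ y in closedBall y₀ ρ, w s y := hmv
    _ ≤ C / ρ ^ (Module.finrank ℝ E + 2) *
        (Real.exp 1 * ∫ s in (t₀ - ρ ^ 2)..t₀, ∫ y in closedBall y₀ ρ, q s y) :=
        mul_le_mul_of_nonneg_left hcomp (div_nonneg hC.le hρn.le)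
    _ = Real.exp 1 * C / ρ ^ (Module.finrank ℝ E + 2) *
        ∫ s in (t₀ - ρ ^ 2)..t₀, ∫ y in closedBall y₀ ρ, q s y := by ring

/-- **Mean-value inequality for linear subsolutions with a constant source, frame form.** If
`q ≥ 0` is jointly smooth on `𝒯 × E` and satisfies `∂ₜq − ∑ᵢ∂ᵢ∂ᵢq ≤ Λ q + S₀` on the cylinder
`[t₀ − ρ², t₀] × B̄_ρ(y₀)` (`[t₀ − ρ², t₀] ⊆ 𝒯`) with `0 ≤ Λ`, `Λ ρ² ≤ 1`, `0 ≤ S₀`, then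
`q(t₀, y₀) ≤ C ρ^{-(n+2)} ∫_{t₀-ρ²}^{t₀} ∫_{B̄_ρ(y₀)} q + C S₀ ρ²`
(apply the linear case with `Λ' = ρ⁻²` to `q + S₀ρ²`, for which
`(∂ₜ − Δ)(q + S₀ρ²) ≤ Λq + S₀ ≤ ρ⁻²(q + S₀ρ²)`; the constant `C` also absorbs the volume of the
unit ball). [cite: Lieberman1996, Thm. 6.17 (m = 1) and Thm. 7.36 (p = 1)] -/
theorem le_mul_integral_add_of_linear_subsolution_source_basis {ι : Type*} [Fintype ι]
    (b : OrthonormalBasis ι ℝ E) :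
    ∃ C : ℝ, 0 < C ∧ ∀ {q : ℝ → E → ℝ} {𝒯 : Set ℝ}, IsOpen 𝒯 →
      ContDiffOn ℝ ∞ (fun p : ℝ × E => q p.1 p.2) (𝒯 ×ˢ (univ : Set E)) →
      ∀ {t₀ : ℝ} {y₀ : E} {ρ Λ S₀ : ℝ}, 0 < ρ → Icc (t₀ - ρ ^ 2) t₀ ⊆ 𝒯 → 0 ≤ Λ → Λ * ρ ^ 2 ≤ 1 →
      0 ≤ S₀ →
      (∀ t ∈ Icc (t₀ - ρ ^ 2) t₀, ∀ y ∈ closedBall y₀ ρ, 0 ≤ q t y) →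
      (∀ t ∈ Icc (t₀ - ρ ^ 2) t₀, ∀ y ∈ closedBall y₀ ρ,
          deriv (fun s => q s y) t -
            ∑ i, fderiv ℝ (fun z => fderiv ℝ (q t) z (b i)) y (b i) ≤ Λ * q t y + S₀) →
      q t₀ y₀ ≤ C / ρ ^ (Module.finrank ℝ E + 2) *
        (∫ t in (t₀ - ρ ^ 2)..t₀, ∫ y in closedBall y₀ ρ, q t y) + C * S₀ * ρ ^ 2 := by
  obtain ⟨C₀, hC₀, hMV⟩ := le_mul_integral_of_linear_subsolution_basis (E := E) b
  set v₁ : ℝ := (volume (closedBall (0 : E) 1)).toReal with hv₁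
  have hv₁0 : 0 ≤ v₁ := ENNReal.toReal_nonneg
  refine ⟨C₀ * (1 + v₁), by positivity, ?_⟩
  intro q 𝒯 h𝒯 hq t₀ y₀ ρ Λ S₀ hρ hI hΛ0 hΛρ hS0 hq0 hsub
  set n := Module.finrank ℝ E with hn
  set c : ℝ := S₀ * ρ ^ 2 with hc
  have hc0 : 0 ≤ c := by positivity
  -- ### the shifted function `q + S₀ρ²` is a linear subsolution with `Λ' = ρ⁻²`
  set q' : ℝ → E → ℝ := fun s y => q s y + c with hq'_def
  have hq'_joint : ContDiffOn ℝ ∞ (fun p : ℝ × E => q' p.1 p.2) (𝒯 ×ˢ (univ : Set E)) :=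
    hq.add contDiffOn_const
  have hq'0 : ∀ t ∈ Icc (t₀ - ρ ^ 2) t₀, ∀ y ∈ closedBall y₀ ρ, 0 ≤ q' t y := fun t ht y hy =>
    add_nonneg (hq0 t ht y hy) hc0
  have hΛ' : 0 ≤ 1 / ρ ^ 2 := by positivity
  have hΛ'ρ : 1 / ρ ^ 2 * ρ ^ 2 ≤ 1 := by rw [one_div, inv_mul_cancel₀ (pow_ne_zero 2 hρ.ne')]
  have hsub' : ∀ t ∈ Icc (t₀ - ρ ^ 2) t₀, ∀ y ∈ closedBall y₀ ρ,
      deriv (fun s => q' s y) t - ∑ i, fderiv ℝ (fun z => fderiv ℝ (q' t) z (b i)) y (b i) ≤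
        1 / ρ ^ 2 * q' t y := by
    intro t ht y hy
    have hd : deriv (fun s => q' s y) t = deriv (fun s => q s y) t := by
      simp only [hq'_def]; exact deriv_add_const c
    have hlap : ∀ i, fderiv ℝ (fun z => fderiv ℝ (q' t) z (b i)) y (b i) =
        fderiv ℝ (fun z => fderiv ℝ (q t) z (b i)) y (b i) := fun i => by
      have h1 : (fun z => fderiv ℝ (q' t) z (b i)) = fun z => fderiv ℝ (q t) z (b i) := by
        funext z
        simp only [hq'_def, fderiv_add_const]
      rw [h1]
    rw [hd, Finset.sum_congr rfl fun i _ => hlap i]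
    have h := hsub t ht y hy
    have hqy := hq0 t ht y hy
    -- `Λ q + S₀ ≤ ρ⁻² (q + S₀ρ²)` since `Λ ≤ ρ⁻²`
    have hΛle : Λ ≤ 1 / ρ ^ 2 := by
      rw [le_div_iff₀ (by positivity)]; linarith only [hΛρ]
    have hrhs : Λ * q t y + S₀ ≤ 1 / ρ ^ 2 * q' t y := by
      have e1 : 1 / ρ ^ 2 * q' t y = 1 / ρ ^ 2 * q t y + S₀ := by
        simp only [hq'_def, hc]; field_simp
      rw [e1]
      linarith only [mul_le_mul_of_nonneg_right hΛle hqy]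
    exact h.trans hrhs
  have hmv := hMV h𝒯 hq'_joint hρ hI hΛ' hΛ'ρ hq'0 hsub'
  -- ### split the integral of `q + c`
  have hle : t₀ - ρ ^ 2 ≤ t₀ := by nlinarith
  have hK : IsCompact (closedBall y₀ ρ) := isCompact_closedBall y₀ ρ
  have hμ : (volume (closedBall y₀ ρ)).toReal = ρ ^ n * v₁ := by
    rw [Measure.addHaar_closedBall' volume y₀ hρ.le, ENNReal.toReal_mul,
      ENNReal.toReal_ofReal (by positivity), hv₁]
  have hfin : volume (closedBall y₀ ρ) < ⊤ := hK.measure_lt_top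
  have hcontI : ∀ {g : ℝ → E → ℝ}, ContDiffOn ℝ ∞ (fun p : ℝ × E => g p.1 p.2) (𝒯 ×ˢ univ) →
      IntervalIntegrable (fun s => ∫ y in closedBall y₀ ρ, g s y) volume (t₀ - ρ ^ 2) t₀ := by
    intro g hg
    set pr : ℝ → ℝ := fun τ => (projIcc (t₀ - ρ ^ 2) t₀ hle τ : ℝ) with hpr
    have hprc : Continuous pr := continuous_subtype_val.comp continuous_projIcc
    have hpr𝒯 : ∀ τ, pr τ ∈ 𝒯 := fun τ => hI (projIcc _ _ hle τ).2
    have hcont : Continuous (fun p : ℝ × E => g (pr p.1) p.2) :=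
      hg.continuousOn.comp_continuous ((hprc.comp continuous_fst).prodMk continuous_snd)
        fun p => ⟨hpr𝒯 p.1, mem_univ _⟩
    have hGt : Continuous fun τ => ∫ y in closedBall y₀ ρ, g (pr τ) y :=
      continuous_parametric_integral_of_continuous (f := fun τ y => g (pr τ) y) hcont hK
    have hGc : ContinuousOn (fun τ => ∫ y in closedBall y₀ ρ, g τ y) (Icc (t₀ - ρ ^ 2) t₀) := by
      refine hGt.continuousOn.congr fun τ hτ => ?_
      simp [hpr, projIcc_of_mem hle hτ]
    exact ContinuousOn.intervalIntegrable (by rwa [uIcc_of_le hle])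
  have hinner : ∀ s ∈ Icc (t₀ - ρ ^ 2) t₀, (∫ y in closedBall y₀ ρ, q' s y) =
      (∫ y in closedBall y₀ ρ, q s y) + c * (ρ ^ n * v₁) := by
    intro s hs
    have hs𝒯 : s ∈ 𝒯 := hI hs
    have hqc : Continuous fun y => q s y :=
      hq.continuousOn.comp_continuous (Continuous.prodMk_right s) fun y => ⟨hs𝒯, mem_univ _⟩
    have hi1 : IntegrableOn (fun y => q s y) (closedBall y₀ ρ) := hqc.continuousOn.integrableOn_compact hK
    have hi2 : IntegrableOn (fun _ : E => c) (closedBall y₀ ρ) := integrableOn_const hfin.ne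
    simp only [hq'_def]
    rw [integral_add hi1 hi2, setIntegral_const, smul_eq_mul, Measure.real, hμ]
    ring
  have hsplit : (∫ s in (t₀ - ρ ^ 2)..t₀, ∫ y in closedBall y₀ ρ, q' s y) =
      (∫ s in (t₀ - ρ ^ 2)..t₀, ∫ y in closedBall y₀ ρ, q s y) + ρ ^ 2 * (c * (ρ ^ n * v₁)) := by
    rw [intervalIntegral.integral_congr (fun s hs => hinner s (by rwa [uIcc_of_le hle] at hs)),
      intervalIntegral.integral_add (hcontI hq) intervalIntegrable_const,
      intervalIntegral.integral_const, smul_eq_mul]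
    ring
  -- ### assemble
  have hq't : q' t₀ y₀ = q t₀ y₀ + c := rfl
  have hI0 : 0 ≤ ∫ s in (t₀ - ρ ^ 2)..t₀, ∫ y in closedBall y₀ ρ, q s y :=
    intervalIntegral.integral_nonneg hle fun s hs =>
      setIntegral_nonneg measurableSet_closedBall fun y hy => hq0 s hs y hy
  rw [hq't, hsplit] at hmv
  have hρn : 0 < ρ ^ (n + 2) := pow_pos hρ _
  have hsource : C₀ / ρ ^ (n + 2) * (ρ ^ 2 * (c * (ρ ^ n * v₁))) = C₀ * v₁ * S₀ * ρ ^ 2 := by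
    rw [hc, pow_add]; field_simp
  have h1 : q t₀ y₀ ≤ C₀ / ρ ^ (n + 2) * (∫ s in (t₀ - ρ ^ 2)..t₀, ∫ y in closedBall y₀ ρ, q s y) +
      C₀ * v₁ * S₀ * ρ ^ 2 := by
    rw [← hsource, ← mul_add]; linarith only [hmv, hc0]
  have h2 : C₀ / ρ ^ (n + 2) * (∫ s in (t₀ - ρ ^ 2)..t₀, ∫ y in closedBall y₀ ρ, q s y) ≤
      C₀ * (1 + v₁) / ρ ^ (n + 2) * (∫ s in (t₀ - ρ ^ 2)..t₀, ∫ y in closedBall y₀ ρ, q s y) := by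
    refine mul_le_mul_of_nonneg_right ?_ hI0
    rw [div_le_div_iff_of_pos_right hρn]
    nlinarith only [hC₀, hv₁0]
  have h3 : C₀ * v₁ * S₀ * ρ ^ 2 ≤ C₀ * (1 + v₁) * S₀ * ρ ^ 2 := by
    have : 0 ≤ C₀ * S₀ * ρ ^ 2 := by positivity
    nlinarith only [this, hC₀, hS0, sq_nonneg ρ]
  linarith only [h1, h2, h3]

end MeanValue

end Literature.Analysis.PDE
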